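import Literature.Analysis.FluidPDE.ChaeChoeTwoComponentsSlab
import Literature.Analysis.FluidPDE.ChaeChoeCriterion
import HarnessLib

/-!
# Chae–Choe's second criterion: the gradients of two velocity components in `L^α(0,T; L^γ)`,
# `2/α + 3/γ = 1`, PROVED

search for candidate a priori estimates; no regularity claim (cell `pub-nsfunc`, literature seat:
a published continuation criterion as a THEOREM; nothing new).

Chae–Choe, *Regularity of solutions to the Navier–Stokes equation*, Electron. J. Differential
Equations 1999 No. 05, Thm. 2: "Let `ṽ = v₁e₁ + v₂e₂` be the first two components of a
Leray–Hopf weak solution of the Navier–Stokes equation corresponding to `v₀ ∈ H¹(ℝ³)` with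
`div v₀ = 0`. Suppose that `Dṽ ∈ L^{α,γ}_T` with `2/α + 3/γ ≤ 1`, where `2 ≤ α ≤ ∞` and
`3 ≤ γ ≤ ∞`, then `v` becomes a classical solution in `(0,T]`." Its proof (pp. 5–6): the energy
balance (12) of the two vorticity components `ω̃ = ω₁e₁ + ω₂e₂`,
`½ d/dt‖ω̃‖² + ν‖∇ω̃‖² = ∫(ω·∇)ṽ·ω̃`, the Hölder–Gagliardo–Nirenberg–Young estimate (13)
`|∫(ω·∇)ṽ·ω̃| ≤ C‖ω‖²₂ + C‖∇ṽ‖_γ^{2γ/(γ−3)}‖ω̃‖²₂ + (ν/2)‖∇ω̃‖²₂`, Grönwall (forcing `C‖ω‖²₂ ∈ L¹`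
by the energy inequality), whence `ω̃ ∈ L^∞(0,T;L²)`, and Thm. 1.

Rendering (that of the tree's `chaeChoe_two_vorticity_components_criterion`, ns.S27): a
classical unforced solution on `ℝ³ × [0, T)` in the Beale–Kato–Majda class on every `[0, T'']`,
`T'' < T`; for an index `k`, the gradients `∇u_j = e_j^* ∘ ∇u`, `j ≠ k`, of the two OTHER velocity
components lie in `L^α(0,T; L^γ)` (operator norm of the covector), `2/α + 3/γ = 1`,
`3 < γ < ∞` (`⇔ 2 < α < ∞`); conclusion `HasSobolevExtensionPast ν u T`. The two vorticity
components are `P_k ω = ω − ω_k e_k` with the constant linear map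
`P_k = 1 − e_k ⊗ e_k^*` (local notation `(ContinuousLinearMap.id ℝ (EuclideanSpace ℝ (Fin 3)) - ContinuousLinearMap.smulRight (EuclideanSpace.proj k : EuclideanSpace ℝ (Fin 3) →L[ℝ] ℝ) (EuclideanSpace.basisFun (Fin 3) ℝ k : EuclideanSpace ℝ (Fin 3)))`).

* `exists_two_mul_integral_proj_stretching_le` — the fixed-time estimate (13) in the form
  `2∫⟪P_kω, P_k((∇v)ω)⟫ ≤ ν∫|∇(P_kω)|²_F + ∫|ω|² + C(‖∇v_{k+1}‖_γ^q + ‖∇v_{k+2}‖_γ^q)∫|P_kω|²`,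
  `q = 2γ/(γ−3)` (Hölder `γ, 2, 2γ/(γ−2)`, interpolation `2`–`6`, Sobolev, Young twice);
* `hasSobolevExtensionPast_of_two_vorticity_components_bounded` — the end of the printed proof:
  two vorticity components bounded in `L²` uniformly on `(0,T)` give continuation (Thm. 1 with
  `α = ∞`, `γ = 2`, `chaeChoe_two_vorticity_components_criterion_of_le`);
* `exists_uniform_sq_norm_proj_curl_bound_of_two_velocity_gradients` — the a priori bound
  `sup_{t<T} ∫|P_kω(t)|² < ∞` (slab Grönwall `integral_sq_norm_clm_curl_le_of_weight_slab_ae`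
  with the enstrophy forcing controlled by Tao's energy class);
* `chaeChoe_two_velocity_gradients_criterion` — **the criterion**;
* `chaeChoe_two_velocity_gradients_criterion_of_le` — the printed hypothesis `2/α + 3/γ ≤ 1`
  for `3 < γ < ∞` and any `α ≤ ∞` (Hölder's inequality in time, `MemLqLp.of_exponent_le`).

* `exists_two_mul_integral_proj_stretching_le_three`, `chaeChoe_two_velocity_gradients_criterion_three`
  — the endpoint `γ = 3`, `α = ∞` (`∇u_j ∈ L^∞(0,T; L³)`, `j ≠ k`).

* `two_mul_integral_proj_stretching_le_top`, `chaeChoe_two_velocity_gradients_criterion_top`,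
  `chaeChoe_two_velocity_gradients_criterion_top_of_le` — the endpoint `γ = ∞`, `2 ≤ α ≤ ∞`
  (`∇u_j ∈ L^α(0,T; L^∞)`, `j ≠ k`; time measurability of `t ↦ ‖∇u_j(t)‖_∞` via a countable
  dense set).

With these, every pair of exponents printed in Thm. 2 (`2/α + 3/γ ≤ 1`, `2 ≤ α ≤ ∞`,
`3 ≤ γ ≤ ∞`) is covered in the Beale–Kato–Majda-class rendering.

## References

* D. Chae, H.-J. Choe, Electron. J. Differential Equations 1999 (1999), No. 05, 1–7: Thm. 2 and
  its proof, (12)–(13) (pp. 2, 5–6; open access, text read). [ChaeChoe1999]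
* T. Tao, Anal. PDE 6 (2013), Lemma 8.1 (energy class). [Tao2011]
-/

noncomputable section

open MeasureTheory Set Function Filter Metric Real InnerProductSpace
open _root_.Topology
open scoped ENNReal NNReal RealInnerProductSpace ContDiff

namespace Literature.Analysis.FluidPDE

-- nested operator types (second derivatives)
set_option maxSynthPendingDepth 3

-- The constant linear map `P_k = 1 − e_k ⊗ e_k^*` of `ℝ³` killing the `k`-th component
-- (Chae–Choe's `ω ↦ ω̃`) is written out as `ContinuousLinearMap.id ℝ _ - smulRight (proj k) (e k)`
-- (no definition and no notation is introduced).

section Pointwise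

/-- `P_k y = y_{k+1} e_{k+1} + y_{k+2} e_{k+2}` (indices mod `3`). [folklore] -/
private theorem dropC_apply_eq (y : EuclideanSpace ℝ (Fin 3)) (k : Fin 3) :
    (ContinuousLinearMap.id ℝ (EuclideanSpace ℝ (Fin 3)) - ContinuousLinearMap.smulRight (EuclideanSpace.proj k : EuclideanSpace ℝ (Fin 3) →L[ℝ] ℝ) (EuclideanSpace.basisFun (Fin 3) ℝ k : EuclideanSpace ℝ (Fin 3))) y = y (k + 1) • EuclideanSpace.basisFun (Fin 3) ℝ (k + 1) +
      y (k + 2) • EuclideanSpace.basisFun (Fin 3) ℝ (k + 2) := by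
  ext i
  fin_cases k <;> fin_cases i <;> simp [EuclideanSpace.basisFun_apply]

/-- `‖P_k y‖ ≤ |y_{k+1}| + |y_{k+2}|`. [folklore] -/
private theorem norm_dropC_apply_le (y : EuclideanSpace ℝ (Fin 3)) (k : Fin 3) :
    ‖(ContinuousLinearMap.id ℝ (EuclideanSpace ℝ (Fin 3)) - ContinuousLinearMap.smulRight (EuclideanSpace.proj k : EuclideanSpace ℝ (Fin 3) →L[ℝ] ℝ) (EuclideanSpace.basisFun (Fin 3) ℝ k : EuclideanSpace ℝ (Fin 3))) y‖ ≤ |y (k + 1)| + |y (k + 2)| := by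
  rw [dropC_apply_eq]
  refine (norm_add_le _ _).trans (add_le_add ?_ ?_) <;>
  · rw [norm_smul, Real.norm_eq_abs]; simp

/-- A component is bounded by the vector: `|y k| ≤ ‖y‖`. [folklore] -/
private theorem abs_apply_le_norm_vg (y : EuclideanSpace ℝ (Fin 3)) (k : Fin 3) : |y k| ≤ ‖y‖ := by
  have h := EuclideanSpace.norm_sq_eq y
  have hk : |y k| ^ 2 ≤ ∑ j, |y j| ^ 2 :=
    Finset.single_le_sum (f := fun j => |y j| ^ 2) (fun j _ => sq_nonneg _) (Finset.mem_univ k)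
  have h2 : |y k| ^ 2 ≤ ‖y‖ ^ 2 := by
    rw [h]
    simpa only [Real.norm_eq_abs] using hk
  exact abs_le_of_sq_le_sq' (by nlinarith [norm_nonneg y, abs_nonneg (y k)]) (norm_nonneg _) |>.2

/-- `‖P_k y‖ ≤ 2‖y‖`. [folklore] -/
private theorem norm_dropC_apply_le_two_mul (y : EuclideanSpace ℝ (Fin 3)) (k : Fin 3) :
    ‖(ContinuousLinearMap.id ℝ (EuclideanSpace ℝ (Fin 3)) - ContinuousLinearMap.smulRight (EuclideanSpace.proj k : EuclideanSpace ℝ (Fin 3) →L[ℝ] ℝ) (EuclideanSpace.basisFun (Fin 3) ℝ k : EuclideanSpace ℝ (Fin 3))) y‖ ≤ 2 * ‖y‖ := by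
  have h1 := abs_apply_le_norm_vg y (k + 1)
  have h2 := abs_apply_le_norm_vg y (k + 2)
  linarith [norm_dropC_apply_le y k]

/-- **Pointwise structure of `⟪ω̃, (ω·∇)ṽ⟫`**: with `G_j = e_j^* ∘ L` (the gradient of the
`j`-th component), `⟪P_k w, P_k(Lw)⟫ ≤ ‖P_k w‖ (‖G_{k+1}‖ + ‖G_{k+2}‖) ‖w‖`
(Chae–Choe: `|∫(ω·∇)ṽ·ω̃| ≤ ∫|ω̃| |∇ṽ| |ω|`). [cite: ChaeChoe1999, proof of Thm. 2, (13) (p. 5)] -/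
theorem inner_dropC_apply_le (w : EuclideanSpace ℝ (Fin 3))
    (L : EuclideanSpace ℝ (Fin 3) →L[ℝ] EuclideanSpace ℝ (Fin 3)) (k : Fin 3) :
    ⟪(ContinuousLinearMap.id ℝ (EuclideanSpace ℝ (Fin 3)) - ContinuousLinearMap.smulRight (EuclideanSpace.proj k : EuclideanSpace ℝ (Fin 3) →L[ℝ] ℝ) (EuclideanSpace.basisFun (Fin 3) ℝ k : EuclideanSpace ℝ (Fin 3))) w, (ContinuousLinearMap.id ℝ (EuclideanSpace ℝ (Fin 3)) - ContinuousLinearMap.smulRight (EuclideanSpace.proj k : EuclideanSpace ℝ (Fin 3) →L[ℝ] ℝ) (EuclideanSpace.basisFun (Fin 3) ℝ k : EuclideanSpace ℝ (Fin 3))) (L w)⟫ ≤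
      ‖(ContinuousLinearMap.id ℝ (EuclideanSpace ℝ (Fin 3)) - ContinuousLinearMap.smulRight (EuclideanSpace.proj k : EuclideanSpace ℝ (Fin 3) →L[ℝ] ℝ) (EuclideanSpace.basisFun (Fin 3) ℝ k : EuclideanSpace ℝ (Fin 3))) w‖ * ((‖(EuclideanSpace.proj (k + 1)).comp L‖ +
        ‖(EuclideanSpace.proj (k + 2)).comp L‖) * ‖w‖) := by
  refine (real_inner_le_norm _ _).trans (mul_le_mul_of_nonneg_left ?_ (norm_nonneg _))
  refine (norm_dropC_apply_le (L w) k).trans ?_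
  rw [add_mul]
  refine add_le_add ?_ ?_
  · have h := ((EuclideanSpace.proj (𝕜 := ℝ) (ι := Fin 3) (k + 1)).comp L).le_opNorm w
    simpa [Real.norm_eq_abs] using h
  · have h := ((EuclideanSpace.proj (𝕜 := ℝ) (ι := Fin 3) (k + 2)).comp L).le_opNorm w
    simpa [Real.norm_eq_abs] using h

end Pointwise

section Estimate

/-- Exponent algebra for (13): for `ρ > 3`, `θ = 3/ρ`, `m = 2ρ/(ρ−2)`, `γ' = ρ/(ρ−1)`,
`p₁ = 2(ρ−1)/ρ`, `q₁ = 2(ρ−1)/(ρ−2)`. [folklore] -/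
private theorem vg_exponent_algebra {ρ : ℝ} (hρ : 3 < ρ) :
    let m : ℝ := 2 * ρ / (ρ - 2)
    let γ' : ℝ := ρ / (ρ - 1)
    let p₁ : ℝ := 2 * (ρ - 1) / ρ
    let q₁ : ℝ := 2 * (ρ - 1) / (ρ - 2)
    2 < m ∧ m < 6 ∧ ρ.HolderConjugate γ' ∧ p₁.HolderConjugate q₁ ∧ 0 < γ' ∧
      γ' * p₁ = 2 ∧ γ' * q₁ = m ∧ 1 / p₁ * (1 / γ') = 1 / 2 ∧ 1 / q₁ * (1 / γ') = 1 / m ∧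
      (6 - m) / (6 - 2) * (2 / m) = 1 - 3 / ρ ∧ (m - 2) / (6 - 2) * (2 / m) = 3 / ρ / 3 := by
  intro m γ' p₁ q₁
  have hρ1 : 0 < ρ - 1 := by linarith
  have hρ2 : 0 < ρ - 2 := by linarith
  have hρ0 : 0 < ρ := by linarith
  have hm : m = 2 * ρ / (ρ - 2) := rfl
  have hγ' : γ' = ρ / (ρ - 1) := rfl
  have hp₁ : p₁ = 2 * (ρ - 1) / ρ := rfl
  have hq₁ : q₁ = 2 * (ρ - 1) / (ρ - 2) := rfl
  refine ⟨?_, ?_, ?_, ?_, ?_, ?_, ?_, ?_, ?_, ?_, ?_⟩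
  · rw [hm, lt_div_iff₀ hρ2]; linarith
  · rw [hm, div_lt_iff₀ hρ2]; linarith
  · rw [Real.holderConjugate_iff]
    refine ⟨by linarith, ?_⟩
    rw [hγ']; field_simp; try ring
  · rw [Real.holderConjugate_iff]
    refine ⟨by rw [hp₁, lt_div_iff₀ hρ0]; linarith, ?_⟩
    rw [hp₁, hq₁]; field_simp; try ring
  · rw [hγ']; positivity
  · rw [hγ', hp₁]; field_simp; try ring
  · rw [hγ', hq₁, hm]; field_simp; try ring
  · rw [hγ', hp₁]; field_simp; try ring
  · rw [hγ', hq₁, hm]; field_simp; try ring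
  · rw [hm]; field_simp; try ring
  · rw [hm]; field_simp; try ring

/-- `(3 : ℝ≥0∞) < γ < ∞` in real terms. [folklore] -/
private theorem toReal_three_lt {γ : ℝ≥0∞} (hγ : 3 < γ) (hγtop : γ ≠ ⊤) : 3 < γ.toReal := by
  have h : ((3 : ℝ≥0∞)).toReal < γ.toReal := (ENNReal.toReal_lt_toReal (by norm_num) hγtop).2 hγ
  rwa [ENNReal.toReal_ofNat] at h

/-- **Three-factor Young inequality** used in (13): for `0 < θ < 1`, `ν > 0`, `A, Z, a, R ≥ 0`,
`A · Z^{1/2} · a^{(1−θ)/2} · R^{θ/2} ≤ (ν/2) R + Z + C_θ(ν) A^{2/(1−θ)} a` with an explicit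
`C_θ(ν)` (Young with exponents `2/θ`, `2`, `2/(1−θ)`). [folklore] -/
private theorem young_three_factor {θ ν : ℝ} (hθ0 : 0 < θ) (hθ1 : θ < 1) (hν : 0 < ν) :
    ∃ C : ℝ, 0 ≤ C ∧ ∀ {A Z a R : ℝ}, 0 ≤ A → 0 ≤ Z → 0 ≤ a → 0 ≤ R →
      A * (Z ^ (1 / 2 : ℝ) * a ^ ((1 - θ) / 2) * R ^ (θ / 2)) ≤
        ν / 2 * R + Z + C * A ^ (2 / (1 - θ)) * a := by
  -- first Young: exponents `1/θ'`, `1/(1-θ')` with `θ' = 1 - θ/2`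
  set θ' : ℝ := 1 - θ / 2 with hθ'
  have hθ'0 : 0 < θ' := by rw [hθ']; linarith
  have hθ'1 : θ' < 1 := by rw [hθ']; linarith
  set c₀ : ℝ := θ' * (2 * (1 - θ')) ^ ((1 - θ') / θ') * ν ^ (-((1 - θ') / θ')) with hc₀
  have hc₀0 : 0 ≤ c₀ := by
    rw [hc₀]
    have : 0 ≤ ν ^ (-((1 - θ') / θ')) := Real.rpow_nonneg hν.le _
    positivity
  -- second Young: weights `θ'' = 1/(2-θ)`, `1 - θ''`
  set θ'' : ℝ := 1 / (2 - θ) with hθ''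
  have h2θ : 0 < 2 - θ := by linarith
  have hθ''0 : 0 < θ'' := by rw [hθ'']; positivity
  have hθ''1 : θ'' < 1 := by rw [hθ'', div_lt_one h2θ]; linarith
  have h1θ'' : 0 < 1 - θ'' := by linarith
  refine ⟨(1 - θ'') * c₀ ^ (1 / (1 - θ'')), by positivity, ?_⟩
  intro A Z a R hA hZ ha hR
  -- `y = Z^{θ''} a^{1-θ''}` and `y^{θ'} = Z^{1/2} a^{(1-θ)/2}`
  set y : ℝ := Z ^ θ'' * a ^ (1 - θ'') with hy
  have hy0 : 0 ≤ y := by positivity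
  have he1 : θ'' * θ' = 1 / 2 := by
    rw [hθ'', hθ']; field_simp; try ring
  have he2 : (1 - θ'') * θ' = (1 - θ) / 2 := by
    rw [hθ'', hθ']; field_simp; try ring
  have he3 : 1 - θ' = θ / 2 := by rw [hθ']; ring
  have hyθ : y ^ θ' = Z ^ (1 / 2 : ℝ) * a ^ ((1 - θ) / 2) := by
    rw [hy, Real.mul_rpow (by positivity) (by positivity), ← Real.rpow_mul hZ, ← Real.rpow_mul ha,
      he1, he2]
  -- first Young
  have h1 : A * y ^ θ' * R ^ (1 - θ') ≤ ν / 2 * R + c₀ * A ^ (1 / θ') * y := by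
    have h := mul_rpow_mul_rpow_le_absorb hθ'0 hθ'1 hν hA hR hy0
    rw [hc₀]; exact h
  have hlhs : A * (Z ^ (1 / 2 : ℝ) * a ^ ((1 - θ) / 2) * R ^ (θ / 2)) = A * y ^ θ' * R ^ (1 - θ') := by
    rw [hyθ, he3]; ring
  -- second Young: `c₀ A^{1/θ'} Z^{θ''} a^{1-θ''} ≤ θ'' Z + (1-θ'') (c₀ A^{1/θ'})^{1/(1-θ'')} a`
  set D : ℝ := c₀ * A ^ (1 / θ') with hD
  have hD0 : 0 ≤ D := by positivity
  have h2 : D * y ≤ θ'' * Z + (1 - θ'') * (D ^ (1 / (1 - θ'')) * a) := by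
    have hDa : D * y = Z ^ θ'' * (D ^ (1 / (1 - θ'')) * a) ^ (1 - θ'') := by
      rw [hy, Real.mul_rpow (by positivity) ha, ← Real.rpow_mul hD0,
        one_div_mul_cancel h1θ''.ne', Real.rpow_one]
      ring
    rw [hDa]
    exact Real.geom_mean_le_arith_mean2_weighted hθ''0.le h1θ''.le hZ (by positivity) (by ring)
  -- the power of `A`
  have hApow : D ^ (1 / (1 - θ'')) = c₀ ^ (1 / (1 - θ'')) * A ^ (2 / (1 - θ)) := by
    rw [hD, Real.mul_rpow hc₀0 (by positivity), ← Real.rpow_mul hA]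
    congr 2
    rw [hθ', hθ'']; field_simp; try ring
  rw [hlhs]
  calc A * y ^ θ' * R ^ (1 - θ') ≤ ν / 2 * R + D * y := by rw [hD]; exact h1
    _ ≤ ν / 2 * R + (θ'' * Z + (1 - θ'') * (D ^ (1 / (1 - θ'')) * a)) := by linarith [h2]
    _ ≤ ν / 2 * R + Z + (1 - θ'') * c₀ ^ (1 / (1 - θ'')) * A ^ (2 / (1 - θ)) * a := by
        rw [hApow]
        have hZle : θ'' * Z ≤ Z := by nlinarith
        nlinarith [hZle]

set_option maxHeartbeats 1600000 in
/-- **Chae–Choe's estimate (13) for the stretching of two vorticity components by the gradients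
of two velocity components** (Chae–Choe 1999, proof of Thm. 2:
`|∫(ω·∇)ṽ·ω̃| ≤ ‖ω‖₂‖∇ṽ‖_γ‖ω̃‖_{2γ/(γ−2)} ≤ C‖ω‖₂‖∇ṽ‖_γ‖ω̃‖₂^{(γ−3)/γ}‖∇ω̃‖₂^{3/γ}
 ≤ C‖ω‖²₂ + C‖∇ṽ‖_γ^{2γ/(γ−3)}‖ω̃‖²₂ + (ν/2)‖∇ω̃‖²₂` "using the Hölder and the Gagliardo–Nirenberg
inequalities"). For `3 < γ < ∞`, `ν > 0` and an index `k` there is `C = C(γ, ν) ≥ 0` such that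
every `C^∞` field `v` on `ℝ³` with `∇v` bounded and `∇v, ∇²v ∈ L²`, whose component gradients
`∇v_{k+1} = e_{k+1}^* ∘ ∇v`, `∇v_{k+2}` lie in `L^γ`, satisfies, with `ω = curl v` and
`P_k ω = ω − ω_k e_k`,
`2∫⟪P_kω, P_k((∇v)ω)⟫ ≤ ν ∫|∇(P_kω)|²_F + ∫|ω|² + C (‖∇v_{k+1}‖_γ^q + ‖∇v_{k+2}‖_γ^q) ∫|P_kω|²`,
`q = 2γ/(γ−3)`: pointwise `inner_dropC_apply_le`, Hölder (`γ`, `γ'`) and (`2`, `2γ/(γ−2)`),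
Lebesgue interpolation `2`–`6` with Sobolev `‖P_kω‖₆ ≤ K‖∇(P_kω)‖₂`, and Young's inequality with
exponents `2/θ, 2, 2/(1−θ)`, `θ = 3/γ` (`young_three_factor`); `(a+b)^q ≤ 2^{q−1}(a^q+b^q)`.
Divergence-freeness is not used at this step. The constant is not the printed one.
[cite: ChaeChoe1999, proof of Thm. 2, (13) (p. 5)] -/
theorem exists_two_mul_integral_proj_stretching_le {γ : ℝ≥0∞} (hγ : 3 < γ) (hγtop : γ ≠ ⊤)
    {ν : ℝ} (hν : 0 < ν) (k : Fin 3) :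
    ∃ C : ℝ, 0 ≤ C ∧ ∀ v : EuclideanSpace ℝ (Fin 3) → EuclideanSpace ℝ (Fin 3), ContDiff ℝ ∞ v →
      ∀ {B₁ : ℝ}, (∀ x, ‖fderiv ℝ v x‖ ≤ B₁) →
      (∫⁻ x, ‖iteratedFDeriv ℝ 1 v x‖ₑ ^ 2 < ⊤) → (∫⁻ x, ‖iteratedFDeriv ℝ 2 v x‖ₑ ^ 2 < ⊤) →
      eLpNorm (fun x => (EuclideanSpace.proj (k + 1) : EuclideanSpace ℝ (Fin 3) →L[ℝ] ℝ).comp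
        (fderiv ℝ v x)) γ volume < ⊤ →
      eLpNorm (fun x => (EuclideanSpace.proj (k + 2) : EuclideanSpace ℝ (Fin 3) →L[ℝ] ℝ).comp
        (fderiv ℝ v x)) γ volume < ⊤ →
        2 * ∫ x, ⟪(ContinuousLinearMap.id ℝ (EuclideanSpace ℝ (Fin 3)) - ContinuousLinearMap.smulRight (EuclideanSpace.proj k : EuclideanSpace ℝ (Fin 3) →L[ℝ] ℝ) (EuclideanSpace.basisFun (Fin 3) ℝ k : EuclideanSpace ℝ (Fin 3))) (curl v x), (ContinuousLinearMap.id ℝ (EuclideanSpace ℝ (Fin 3)) - ContinuousLinearMap.smulRight (EuclideanSpace.proj k : EuclideanSpace ℝ (Fin 3) →L[ℝ] ℝ) (EuclideanSpace.basisFun (Fin 3) ℝ k : EuclideanSpace ℝ (Fin 3))) (fderiv ℝ v x (curl v x))⟫ ≤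
          ν * (∫ x, frobeniusNormSq (fderiv ℝ (fun y => (ContinuousLinearMap.id ℝ (EuclideanSpace ℝ (Fin 3)) - ContinuousLinearMap.smulRight (EuclideanSpace.proj k : EuclideanSpace ℝ (Fin 3) →L[ℝ] ℝ) (EuclideanSpace.basisFun (Fin 3) ℝ k : EuclideanSpace ℝ (Fin 3))) (curl v y)) x)) +
            (∫ x, ‖curl v x‖ ^ 2) +
            C * ((eLpNorm (fun x => (EuclideanSpace.proj (k + 1) :
                    EuclideanSpace ℝ (Fin 3) →L[ℝ] ℝ).comp (fderiv ℝ v x)) γ volume).toReal ^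
                  (2 * γ.toReal / (γ.toReal - 3)) +
                (eLpNorm (fun x => (EuclideanSpace.proj (k + 2) :
                    EuclideanSpace ℝ (Fin 3) →L[ℝ] ℝ).comp (fderiv ℝ v x)) γ volume).toReal ^
                  (2 * γ.toReal / (γ.toReal - 3))) *
              ∫ x, ‖(ContinuousLinearMap.id ℝ (EuclideanSpace ℝ (Fin 3)) - ContinuousLinearMap.smulRight (EuclideanSpace.proj k : EuclideanSpace ℝ (Fin 3) →L[ℝ] ℝ) (EuclideanSpace.basisFun (Fin 3) ℝ k : EuclideanSpace ℝ (Fin 3))) (curl v x)‖ ^ 2 := by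
  set K : ℝ≥0 := SNormLESNormFDerivOfEqConst (EuclideanSpace ℝ (Fin 3))
    (volume : Measure (EuclideanSpace ℝ (Fin 3))) 2 with hK
  set P : EuclideanSpace ℝ (Fin 3) →L[ℝ] EuclideanSpace ℝ (Fin 3) := (ContinuousLinearMap.id ℝ (EuclideanSpace ℝ (Fin 3)) - ContinuousLinearMap.smulRight (EuclideanSpace.proj k : EuclideanSpace ℝ (Fin 3) →L[ℝ] ℝ) (EuclideanSpace.basisFun (Fin 3) ℝ k : EuclideanSpace ℝ (Fin 3))) with hPdef
  -- the real exponents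
  have hγ0 : γ ≠ 0 := (lt_trans (by norm_num) hγ).ne'
  set ρ : ℝ := γ.toReal with hρ
  have hρ3 : 3 < ρ := toReal_three_lt hγ hγtop
  have hρ0 : 0 < ρ := by linarith
  obtain ⟨h2m, hm6, hconj, hconj₁, hγ'0, hγ'p, hγ'q, he12, he1m, hexpa, hexpb⟩ :=
    vg_exponent_algebra hρ3
  set m : ℝ := 2 * ρ / (ρ - 2) with hm
  set γ' : ℝ := ρ / (ρ - 1) with hγ'def
  set p₁ : ℝ := 2 * (ρ - 1) / ρ with hp₁
  set q₁ : ℝ := 2 * (ρ - 1) / (ρ - 2) with hq₁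
  have hm0 : 0 < m := by linarith
  set θ : ℝ := 3 / ρ with hθ
  have hθ0 : 0 < θ := by rw [hθ]; positivity
  have hθ1 : θ < 1 := by rw [hθ, div_lt_one hρ0]; exact hρ3
  have h1θ : 0 < 1 - θ := by linarith
  set q : ℝ := 2 * ρ / (ρ - 3) with hqdef
  have hqθ : q = 2 / (1 - θ) := by
    rw [hqdef, hθ]
    have : (ρ - 3) ≠ 0 := by linarith
    field_simp
  have hq1 : 1 ≤ q := by
    rw [hqθ, le_div_iff₀ h1θ]; linarith
  have hq0 : 0 ≤ q := le_trans zero_le_one hq1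
  -- the constants
  obtain ⟨CY, hCY0, hYoung⟩ := young_three_factor hθ0 hθ1 hν
  set C : ℝ := CY * (2 * (K : ℝ) ^ θ) ^ q * (2 : ℝ) ^ (q - 1) with hCdef
  have hC0 : 0 ≤ C := by rw [hCdef]; positivity
  refine ⟨C, hC0, ?_⟩
  intro v hv B₁ hB₁ hv1 hv2' hN1 hN2
  -- the vorticity, its two components `w = P ω`, the component gradients, and their regularity
  have hv3 : ContDiff ℝ 3 v := hv.of_le (by norm_cast)
  set om : EuclideanSpace ℝ (Fin 3) → EuclideanSpace ℝ (Fin 3) := curl v with homdef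
  have hom : ContDiff ℝ ∞ om := contDiff_curl (n := ⊤) (hv.of_le (by exact_mod_cast le_top))
  have hom1 : ContDiff ℝ 1 om := hom.of_le (by norm_cast)
  set w : EuclideanSpace ℝ (Fin 3) → EuclideanSpace ℝ (Fin 3) := fun x => P (om x) with hwdef
  have hw : ContDiff ℝ ∞ w := hom.continuousLinearMap_comp P
  have hw1 : ContDiff ℝ 1 w := hw.of_le (by norm_cast)
  have cω : Continuous om := hom.continuous
  have cw : Continuous w := hw.continuous
  have cDv : Continuous (fderiv ℝ v) := hv.continuous_fderiv (by simp)
  set G : Fin 3 → EuclideanSpace ℝ (Fin 3) → (EuclideanSpace ℝ (Fin 3) →L[ℝ] ℝ) := fun j x =>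
    (EuclideanSpace.proj j : EuclideanSpace ℝ (Fin 3) →L[ℝ] ℝ).comp (fderiv ℝ v x) with hGdef
  have cG : ∀ j, Continuous (G j) := fun j => continuous_const.clm_comp cDv
  have hB₁0 : 0 ≤ B₁ := (norm_nonneg _).trans (hB₁ 0)
  have hGle : ∀ j x, ‖G j x‖ ≤ ‖fderiv ℝ v x‖ := by
    intro j x
    refine ContinuousLinearMap.opNorm_le_bound _ (norm_nonneg _) fun y => ?_
    rw [hGdef]
    dsimp only
    rw [ContinuousLinearMap.comp_apply, Real.norm_eq_abs]
    exact (abs_apply_le_norm_vg _ j).trans ((fderiv ℝ v x).le_opNorm y)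
  -- `ω, Pω, ∇(Pω) ∈ L²`
  set κ : ℝ := ‖curlCLM‖ with hκ
  have l2ω : ∫⁻ x, ‖om x‖ₑ ^ 2 < ⊤ :=
    lt_of_le_of_lt (lintegral_curl_sq_le v) (ENNReal.mul_lt_top ENNReal.ofReal_lt_top hv1)
  have l2w : ∫⁻ x, ‖w x‖ₑ ^ 2 < ⊤ := by
    refine lintegral_enorm_sq_lt_top_of_norm_le (fun x => ?_) (lintegral_enorm_sq_const_smul_lt_top (2 : ℝ) l2ω)
    rw [norm_smul, Real.norm_of_nonneg (by norm_num : (0 : ℝ) ≤ 2)]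
    exact norm_dropC_apply_le_two_mul (om x) k
  have hDw : ∀ x, fderiv ℝ w x = P.comp (fderiv ℝ om x) := fun x =>
    (P.hasFDerivAt.comp x ((hom1.differentiable one_ne_zero) x).hasFDerivAt).fderiv
  have l2Dw : ∫⁻ x, ‖fderiv ℝ w x‖ₑ ^ 2 < ⊤ := by
    have hle : ∀ x, ‖fderiv ℝ w x‖ ≤ ‖(‖P‖ * κ) • iteratedFDeriv ℝ 2 v x‖ := fun x => by
      rw [norm_smul, Real.norm_of_nonneg (by positivity), hDw, mul_assoc]
      refine (P.opNorm_comp_le _).trans (mul_le_mul_of_nonneg_left ?_ (norm_nonneg _))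
      have h1 : ‖fderiv ℝ om x‖ = ‖iteratedFDeriv ℝ 1 om x‖ := by
        rw [← norm_iteratedFDeriv_fderiv, norm_iteratedFDeriv_zero]
      rw [h1, homdef]
      exact norm_iteratedFDeriv_curl_le_opNorm_mul hv3 1 (by norm_num) x
    exact lintegral_enorm_sq_lt_top_of_norm_le hle (lintegral_enorm_sq_const_smul_lt_top _ hv2')
  -- the real quantities `Z = ∫|ω|²`, `a = ∫|Pω|²`, `R = ∫|∇(Pω)|²_F`
  have i_Z : Integrable (fun x => ‖om x‖ ^ 2) volume := integrable_sq_norm_of_lintegral_lt_top cω l2ω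
  have i_a : Integrable (fun x => ‖w x‖ ^ 2) volume := integrable_sq_norm_of_lintegral_lt_top cw l2w
  set Z : ℝ := ∫ x, ‖om x‖ ^ 2 with hZ
  set a : ℝ := ∫ x, ‖w x‖ ^ 2 with ha
  have hZ0 : 0 ≤ Z := integral_nonneg fun x => sq_nonneg _
  have ha0 : 0 ≤ a := integral_nonneg fun x => sq_nonneg _
  have hRlt : ∫⁻ x, ENNReal.ofReal (frobeniusNormSq (fderiv ℝ w x)) < ⊤ := by
    calc ∫⁻ x, ENNReal.ofReal (frobeniusNormSq (fderiv ℝ w x))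
        ≤ ∫⁻ x, 3 * ‖fderiv ℝ w x‖ₑ ^ 2 :=
          lintegral_mono fun x => ofReal_frobeniusNormSq_le_three_mul_enorm_sq _
      _ = 3 * ∫⁻ x, ‖fderiv ℝ w x‖ₑ ^ 2 := lintegral_const_mul' _ _ (by norm_num)
      _ < ⊤ := ENNReal.mul_lt_top (by norm_num) l2Dw
  have i_R : Integrable (fun x => frobeniusNormSq (fderiv ℝ w x)) volume :=
    integrable_of_continuous_of_nonneg (continuous_frobeniusNormSq_fderiv hw1 (by simp))
      (fun x => frobeniusNormSq_nonneg _) hRlt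
  set R : ℝ := ∫ x, frobeniusNormSq (fderiv ℝ w x) with hR
  have hR0 : 0 ≤ R := integral_nonneg fun x => frobeniusNormSq_nonneg _
  have hRE : ENNReal.ofReal R = ∫⁻ x, ENNReal.ofReal (frobeniusNormSq (fderiv ℝ w x)) :=
    ofReal_integral_eq_lintegral_ofReal i_R (Eventually.of_forall fun x => frobeniusNormSq_nonneg _)
  have hD : eLpNorm (fderiv ℝ w) 2 volume ^ 2 ≤ ENNReal.ofReal R := by
    rw [← lintegral_enorm_sq_eq_eLpNorm_two_sq, hRE]
    refine lintegral_mono fun x => ?_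
    rw [← ofReal_norm, ← ENNReal.ofReal_pow (norm_nonneg _)]
    exact ENNReal.ofReal_le_ofReal (sq_opNorm_le_frobeniusNormSq _)
  have hZE : ENNReal.ofReal Z = ∫⁻ x, ‖om x‖ₑ ^ (2 : ℝ) := by
    rw [hZ, ofReal_integral_eq_lintegral_ofReal i_Z (Eventually.of_forall fun x => sq_nonneg _)]
    refine lintegral_congr fun x => ?_
    rw [← ofReal_norm, ENNReal.ofReal_rpow_of_nonneg (norm_nonneg _) (by norm_num), Real.rpow_two]
  have hAE : ENNReal.ofReal a = ∫⁻ x, ‖w x‖ₑ ^ (2 : ℝ) := by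
    rw [ha, ofReal_integral_eq_lintegral_ofReal i_a (Eventually.of_forall fun x => sq_nonneg _)]
    refine lintegral_congr fun x => ?_
    rw [← ofReal_norm, ENNReal.ofReal_rpow_of_nonneg (norm_nonneg _) (by norm_num), Real.rpow_two]
  -- the two controlled component gradients
  set N₁ : ℝ≥0 := (eLpNorm (G (k + 1)) γ volume).toNNReal with hN₁
  set N₂ : ℝ≥0 := (eLpNorm (G (k + 2)) γ volume).toNNReal with hN₂
  have hN₁E : ((N₁ : ℝ≥0) : ℝ≥0∞) = eLpNorm (G (k + 1)) γ volume := ENNReal.coe_toNNReal hN1.ne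
  have hN₂E : ((N₂ : ℝ≥0) : ℝ≥0∞) = eLpNorm (G (k + 2)) γ volume := ENNReal.coe_toNNReal hN2.ne
  have hN₁R : (eLpNorm (G (k + 1)) γ volume).toReal = (N₁ : ℝ) := rfl
  have hN₂R : (eLpNorm (G (k + 2)) γ volume).toReal = (N₂ : ℝ) := rfl
  -- the pointwise structure bound and the majorant `g`
  set g : EuclideanSpace ℝ (Fin 3) → ℝ := fun x =>
    ‖w x‖ * ((‖G (k + 1) x‖ + ‖G (k + 2) x‖) * ‖om x‖) with hg
  have hg0 : ∀ x, 0 ≤ g x := fun x => by positivity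
  have hSg : ∀ x, ⟪w x, P (fderiv ℝ v x (om x))⟫ ≤ g x := fun x =>
    inner_dropC_apply_le (om x) (fderiv ℝ v x) k
  have hgm : AEStronglyMeasurable g volume :=
    (cw.norm.mul ((((cG _).norm).add ((cG _).norm)).mul cω.norm)).aestronglyMeasurable
  have i_g : Integrable g volume := by
    have hdom : Integrable (fun x => 4 * B₁ * ‖om x‖ ^ 2) volume := i_Z.const_mul _
    refine hdom.mono' hgm (Eventually.of_forall fun x => ?_)
    rw [Real.norm_of_nonneg (hg0 x), hg]
    dsimp only
    have h1 : ‖G (k + 1) x‖ ≤ B₁ := (hGle _ x).trans (hB₁ x)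
    have h2 : ‖G (k + 2) x‖ ≤ B₁ := (hGle _ x).trans (hB₁ x)
    have h3 : ‖w x‖ ≤ 2 * ‖om x‖ := norm_dropC_apply_le_two_mul (om x) k
    have hw0 : 0 ≤ ‖om x‖ := norm_nonneg _
    calc ‖w x‖ * ((‖G (k + 1) x‖ + ‖G (k + 2) x‖) * ‖om x‖)
        ≤ (2 * ‖om x‖) * ((B₁ + B₁) * ‖om x‖) := by gcongr
      _ = 4 * B₁ * ‖om x‖ ^ 2 := by ring
  have hSle : ∫ x, ⟪w x, P (fderiv ℝ v x (om x))⟫ ≤ ∫ x, g x := by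
    by_cases hS : Integrable (fun x => ⟪w x, P (fderiv ℝ v x (om x))⟫) volume
    · exact integral_mono hS i_g hSg
    · rw [integral_undef hS]; exact integral_nonneg hg0
  -- `ℝ≥0∞` form of `∫ g`
  set Wm : ℝ≥0∞ := (∫⁻ x, ‖w x‖ₑ ^ m) ^ (1 / m) with hWm
  set Wm2 : ℝ≥0∞ := (∫⁻ x, ‖w x‖ₑ ^ m) ^ (2 / m) with hWm2
  have hWmsq : Wm = Wm2 ^ (1 / 2 : ℝ) := by
    rw [hWm, hWm2, ← ENNReal.rpow_mul]
    congr 1; field_simp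
  have hpt : ∀ x, ENNReal.ofReal (g x) =
      ‖G (k + 1) x‖ₑ * (‖om x‖ₑ * ‖w x‖ₑ) + ‖G (k + 2) x‖ₑ * (‖om x‖ₑ * ‖w x‖ₑ) := by
    intro x
    rw [hg]
    dsimp only
    rw [ENNReal.ofReal_mul (norm_nonneg _), ENNReal.ofReal_mul (by positivity),
      ENNReal.ofReal_add (norm_nonneg _) (norm_nonneg _)]
    simp only [ofReal_norm]
    ring
  have mω : AEMeasurable (fun x => ‖om x‖ₑ) volume := cω.aemeasurable.enorm
  have mw : AEMeasurable (fun x => ‖w x‖ₑ) volume := cw.aemeasurable.enorm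
  have mG : ∀ j, AEMeasurable (fun x => ‖G j x‖ₑ) volume := fun j => (cG j).aemeasurable.enorm
  -- Hölder (`2`, `m`) inside the `L^{γ'}` norm: `‖ |ω| |Pω| ‖_{γ'} ≤ ‖ω‖₂ ‖Pω‖_m`
  have hCS : (∫⁻ x, (‖om x‖ₑ * ‖w x‖ₑ) ^ γ') ^ (1 / γ') ≤ (∫⁻ x, ‖om x‖ₑ ^ (2 : ℝ)) ^ (1 / 2 : ℝ) * Wm := by
    have hmul : ∀ x, (‖om x‖ₑ * ‖w x‖ₑ) ^ γ' = ‖om x‖ₑ ^ γ' * ‖w x‖ₑ ^ γ' := fun x =>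
      ENNReal.mul_rpow_of_nonneg _ _ hγ'0.le
    have hpowf : ∀ y : ℝ≥0∞, (y ^ γ') ^ p₁ = y ^ (2 : ℝ) := fun y => by
      rw [← ENNReal.rpow_mul, hγ'p]
    have hpowg : ∀ y : ℝ≥0∞, (y ^ γ') ^ q₁ = y ^ m := fun y => by
      rw [← ENNReal.rpow_mul, hγ'q]
    have hcs := ENNReal.lintegral_mul_le_Lp_mul_Lq volume hconj₁
      (f := fun x => ‖om x‖ₑ ^ γ') (g := fun x => ‖w x‖ₑ ^ γ')
      (mω.pow_const _) (mw.pow_const _)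
    simp only [Pi.mul_apply, hpowf, hpowg] at hcs
    calc (∫⁻ x, (‖om x‖ₑ * ‖w x‖ₑ) ^ γ') ^ (1 / γ')
        = (∫⁻ x, ‖om x‖ₑ ^ γ' * ‖w x‖ₑ ^ γ') ^ (1 / γ') := by
          rw [lintegral_congr fun x => hmul x]
      _ ≤ ((∫⁻ x, ‖om x‖ₑ ^ (2 : ℝ)) ^ (1 / p₁) * (∫⁻ x, ‖w x‖ₑ ^ m) ^ (1 / q₁)) ^ (1 / γ') := by
          gcongr
      _ = (∫⁻ x, ‖om x‖ₑ ^ (2 : ℝ)) ^ (1 / 2 : ℝ) * Wm := by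
          rw [ENNReal.mul_rpow_of_nonneg _ _ (by positivity), ← ENNReal.rpow_mul, ← ENNReal.rpow_mul,
            he12, he1m, hWm]
  -- Hölder (`γ`, `γ'`) for each component gradient
  have hT : ∀ j, ∫⁻ x, ‖G j x‖ₑ * (‖om x‖ₑ * ‖w x‖ₑ) ≤
      eLpNorm (G j) γ volume * ((∫⁻ x, ‖om x‖ₑ ^ (2 : ℝ)) ^ (1 / 2 : ℝ) * Wm) := by
    intro j
    have h := ENNReal.lintegral_mul_le_Lp_mul_Lq volume hconj (f := fun x => ‖G j x‖ₑ)
      (g := fun x => ‖om x‖ₑ * ‖w x‖ₑ) (mG j) (mω.mul mw)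
    simp only [Pi.mul_apply] at h
    have hf : (∫⁻ x, ‖G j x‖ₑ ^ ρ) ^ (1 / ρ) = eLpNorm (G j) γ volume := by
      rw [eLpNorm_eq_lintegral_rpow_enorm_toReal hγ0 hγtop, ← hρ]
    rw [hf] at h
    exact h.trans (mul_le_mul' le_rfl hCS)
  -- the bound for `∫ g` in `ℝ≥0∞`
  have hsum : ENNReal.ofReal (∫ x, g x) ≤ ((N₁ : ℝ≥0∞) + N₂) * ((∫⁻ x, ‖om x‖ₑ ^ (2 : ℝ)) ^ (1 / 2 : ℝ) * Wm) := by
    rw [ofReal_integral_eq_lintegral_ofReal i_g (Eventually.of_forall hg0)]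
    have m1 : AEMeasurable (fun x => ‖G (k + 1) x‖ₑ * (‖om x‖ₑ * ‖w x‖ₑ)) volume :=
      (mG _).mul (mω.mul mw)
    calc ∫⁻ x, ENNReal.ofReal (g x)
        = ∫⁻ x, (‖G (k + 1) x‖ₑ * (‖om x‖ₑ * ‖w x‖ₑ) + ‖G (k + 2) x‖ₑ * (‖om x‖ₑ * ‖w x‖ₑ)) :=
          lintegral_congr hpt
      _ = (∫⁻ x, ‖G (k + 1) x‖ₑ * (‖om x‖ₑ * ‖w x‖ₑ)) +
            ∫⁻ x, ‖G (k + 2) x‖ₑ * (‖om x‖ₑ * ‖w x‖ₑ) := lintegral_add_left' m1 _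
      _ ≤ (N₁ : ℝ≥0∞) * ((∫⁻ x, ‖om x‖ₑ ^ (2 : ℝ)) ^ (1 / 2 : ℝ) * Wm) + (N₂ : ℝ≥0∞) * ((∫⁻ x, ‖om x‖ₑ ^ (2 : ℝ)) ^ (1 / 2 : ℝ) * Wm) := by
          have h1' := hT (k + 1)
          have h2' := hT (k + 2)
          rw [← hN₁E] at h1'
          rw [← hN₂E] at h2'
          exact add_le_add h1' h2'
      _ = ((N₁ : ℝ≥0∞) + N₂) * ((∫⁻ x, ‖om x‖ₑ ^ (2 : ℝ)) ^ (1 / 2 : ℝ) * Wm) := by ring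
  -- interpolation `2`–`6` and Sobolev: `‖Pω‖_m² ≤ a^{1-θ} (K² R)^θ`
  have hS : eLpNorm w 6 volume ≤ K * eLpNorm (fderiv ℝ w) 2 volume :=
    eLpNorm_six_le_eLpNorm_fderiv_two volume finrank_euclideanSpace_fin hw1
      (eLpNorm_two_lt_top_of_lintegral_enorm_sq_lt_top l2w)
  have hS6 : ∫⁻ x, ‖w x‖ₑ ^ (6 : ℝ) ≤ ((K : ℝ≥0∞) ^ 2 * ENNReal.ofReal R) ^ (3 : ℝ) := by
    have h6 : ∫⁻ x, ‖w x‖ₑ ^ (6 : ℝ) = eLpNorm w 6 volume ^ (6 : ℝ) := by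
      rw [eLpNorm_eq_lintegral_rpow_enorm_toReal (by norm_num) (by norm_num), ENNReal.toReal_ofNat,
        ← ENNReal.rpow_mul]
      norm_num
    rw [h6]
    calc eLpNorm w 6 volume ^ (6 : ℝ) ≤ (K * eLpNorm (fderiv ℝ w) 2 volume) ^ (6 : ℝ) := by gcongr
      _ = ((K : ℝ≥0∞) ^ 2 * eLpNorm (fderiv ℝ w) 2 volume ^ 2) ^ (3 : ℝ) := by
          rw [← mul_pow, ← ENNReal.rpow_natCast, ← ENNReal.rpow_mul]; norm_num
      _ ≤ ((K : ℝ≥0∞) ^ 2 * ENNReal.ofReal R) ^ (3 : ℝ) := by gcongr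
  have hInterp : ∫⁻ x, ‖w x‖ₑ ^ m ≤
      (∫⁻ x, ‖w x‖ₑ ^ (2 : ℝ)) ^ ((6 - m) / (6 - 2)) * (∫⁻ x, ‖w x‖ₑ ^ (6 : ℝ)) ^ ((m - 2) / (6 - 2)) :=
    lintegral_rpow_interpolate cw.aemeasurable.enorm zero_lt_two (by norm_num) h2m.le hm6.le
  have hθ3 : (3 : ℝ) * (3 / ρ / 3) = θ := by rw [hθ]; ring
  have hWm2_le : Wm2 ≤ ENNReal.ofReal a ^ (1 - θ) * ((K : ℝ≥0∞) ^ 2 * ENNReal.ofReal R) ^ θ := by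
    rw [hWm2]
    calc (∫⁻ x, ‖w x‖ₑ ^ m) ^ (2 / m)
        ≤ ((∫⁻ x, ‖w x‖ₑ ^ (2 : ℝ)) ^ ((6 - m) / (6 - 2)) *
            (∫⁻ x, ‖w x‖ₑ ^ (6 : ℝ)) ^ ((m - 2) / (6 - 2))) ^ (2 / m) := by gcongr
      _ = (∫⁻ x, ‖w x‖ₑ ^ (2 : ℝ)) ^ (1 - θ) * ((∫⁻ x, ‖w x‖ₑ ^ (6 : ℝ)) ^ (3 / ρ / 3)) := by
          rw [ENNReal.mul_rpow_of_nonneg _ _ (by positivity), ← ENNReal.rpow_mul,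
            ← ENNReal.rpow_mul, hexpa, hexpb, hθ]
      _ ≤ (∫⁻ x, ‖w x‖ₑ ^ (2 : ℝ)) ^ (1 - θ) *
            ((((K : ℝ≥0∞) ^ 2 * ENNReal.ofReal R) ^ (3 : ℝ)) ^ (3 / ρ / 3)) := by gcongr
      _ = ENNReal.ofReal a ^ (1 - θ) * ((K : ℝ≥0∞) ^ 2 * ENNReal.ofReal R) ^ θ := by
          rw [hAE, ← ENNReal.rpow_mul, hθ3]
  have hWm_le : Wm ≤ (ENNReal.ofReal a ^ (1 - θ) * ((K : ℝ≥0∞) ^ 2 * ENNReal.ofReal R) ^ θ) ^ (1 / 2 : ℝ) := by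
    rw [hWmsq]; gcongr
  -- back to the reals
  have hfin : ((N₁ : ℝ≥0∞) + N₂) * ((∫⁻ x, ‖om x‖ₑ ^ (2 : ℝ)) ^ (1 / 2 : ℝ) *
      (ENNReal.ofReal a ^ (1 - θ) * ((K : ℝ≥0∞) ^ 2 * ENNReal.ofReal R) ^ θ) ^ (1 / 2 : ℝ)) ≠ ⊤ := by
    rw [← hZE]
    refine ENNReal.mul_ne_top (by simp) (ENNReal.mul_ne_top ?_ ?_)
    · exact ENNReal.rpow_ne_top_of_nonneg (by norm_num) ENNReal.ofReal_ne_top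
    · refine ENNReal.rpow_ne_top_of_nonneg (by norm_num) (ENNReal.mul_ne_top ?_ ?_)
      · exact ENNReal.rpow_ne_top_of_nonneg h1θ.le ENNReal.ofReal_ne_top
      · exact ENNReal.rpow_ne_top_of_nonneg hθ0.le
          (ENNReal.mul_ne_top (ENNReal.pow_ne_top ENNReal.coe_ne_top) ENNReal.ofReal_ne_top)
  have hgR : ∫ x, g x ≤ ((N₁ : ℝ) + N₂) * (Z ^ (1 / 2 : ℝ) *
      (a ^ (1 - θ) * ((K : ℝ) ^ 2 * R) ^ θ) ^ (1 / 2 : ℝ)) := by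
    have h1 : ENNReal.ofReal (∫ x, g x) ≤ ((N₁ : ℝ≥0∞) + N₂) * ((∫⁻ x, ‖om x‖ₑ ^ (2 : ℝ)) ^ (1 / 2 : ℝ) *
        (ENNReal.ofReal a ^ (1 - θ) * ((K : ℝ≥0∞) ^ 2 * ENNReal.ofReal R) ^ θ) ^ (1 / 2 : ℝ)) :=
      hsum.trans (mul_le_mul' le_rfl (mul_le_mul' le_rfl hWm_le))
    have h2 := (ENNReal.ofReal_le_iff_le_toReal hfin).1 h1
    refine h2.trans_eq ?_
    rw [← hZE, ENNReal.toReal_mul, ENNReal.toReal_mul, ← ENNReal.toReal_rpow, ← ENNReal.toReal_rpow,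
      ENNReal.toReal_mul, ← ENNReal.toReal_rpow, ← ENNReal.toReal_rpow, ENNReal.toReal_mul,
      ENNReal.toReal_pow, ENNReal.toReal_ofReal hZ0, ENNReal.toReal_ofReal ha0,
      ENNReal.toReal_ofReal hR0, ENNReal.toReal_add ENNReal.coe_ne_top ENNReal.coe_ne_top,
      ENNReal.coe_toReal, ENNReal.coe_toReal, ENNReal.coe_toReal]
  -- rearrangement of the right-hand side
  have hsplit : (a ^ (1 - θ) * ((K : ℝ) ^ 2 * R) ^ θ) ^ (1 / 2 : ℝ) =
      a ^ ((1 - θ) / 2) * ((K : ℝ) ^ θ * R ^ (θ / 2)) := by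
    have hK0 : 0 ≤ (K : ℝ) := K.2
    rw [Real.mul_rpow (by positivity) (by positivity), ← Real.rpow_mul ha0,
      Real.mul_rpow (by positivity) hR0, Real.mul_rpow (by positivity) (by positivity),
      ← Real.rpow_mul hR0, ← Real.rpow_natCast (K : ℝ) 2, ← Real.rpow_mul hK0, ← Real.rpow_mul hK0]
    congr 1
    · congr 1; ring
    · congr 1
      · congr 1; push_cast; ring
      · congr 1; ring
  set Nr : ℝ := (N₁ : ℝ) + N₂ with hNr
  have hNr0 : 0 ≤ Nr := by positivity
  have hK0 : 0 ≤ (K : ℝ) := K.2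
  set A₀ : ℝ := 2 * (K : ℝ) ^ θ * Nr with hA₀
  have hA₀0 : 0 ≤ A₀ := by positivity
  have h2g : 2 * ∫ x, g x ≤ A₀ * (Z ^ (1 / 2 : ℝ) * a ^ ((1 - θ) / 2) * R ^ (θ / 2)) := by
    have := hgR
    rw [hsplit] at this
    calc 2 * ∫ x, g x ≤ 2 * (Nr * (Z ^ (1 / 2 : ℝ) * (a ^ ((1 - θ) / 2) * ((K : ℝ) ^ θ * R ^ (θ / 2))))) := by
          linarith
      _ = A₀ * (Z ^ (1 / 2 : ℝ) * a ^ ((1 - θ) / 2) * R ^ (θ / 2)) := by rw [hA₀]; ring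
  -- Young's inequality
  have hyoung : 2 * ∫ x, g x ≤ ν / 2 * R + Z + CY * A₀ ^ (2 / (1 - θ)) * a :=
    h2g.trans (hYoung hA₀0 hZ0 ha0 hR0)
  -- the constant: `A₀^q = (2K^θ)^q Nr^q ≤ (2K^θ)^q 2^{q-1} (N₁^q + N₂^q)`
  have hconv : Nr ^ q ≤ (2 : ℝ) ^ (q - 1) * ((N₁ : ℝ) ^ q + (N₂ : ℝ) ^ q) := by
    have h := NNReal.rpow_add_le_mul_rpow_add_rpow N₁ N₂ hq1
    have h' := NNReal.coe_le_coe.2 h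
    push_cast at h'
    rw [hNr]
    exact h'
  have hA₀q : A₀ ^ (2 / (1 - θ)) ≤ (2 * (K : ℝ) ^ θ) ^ q * ((2 : ℝ) ^ (q - 1) * ((N₁ : ℝ) ^ q + (N₂ : ℝ) ^ q)) := by
    rw [← hqθ, hA₀, Real.mul_rpow (by positivity) hNr0]
    exact mul_le_mul_of_nonneg_left hconv (by positivity)
  -- conclusion
  have hmain : 2 * ∫ x, g x ≤ ν * R + Z + C * (((N₁ : ℝ) ^ q + (N₂ : ℝ) ^ q)) * a := by
    have h3 : CY * A₀ ^ (2 / (1 - θ)) * a ≤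
        CY * ((2 * (K : ℝ) ^ θ) ^ q * ((2 : ℝ) ^ (q - 1) * ((N₁ : ℝ) ^ q + (N₂ : ℝ) ^ q))) * a := by
      gcongr
    have hνR : ν / 2 * R ≤ ν * R := by nlinarith
    rw [hCdef]
    nlinarith [hyoung, h3, ha0, hνR]
  calc 2 * ∫ x, ⟪w x, P (fderiv ℝ v x (om x))⟫ ≤ 2 * ∫ x, g x := by linarith [hSle]
    _ ≤ ν * R + Z + C * (((N₁ : ℝ) ^ q + (N₂ : ℝ) ^ q)) * a := hmain
    _ = ν * R + Z + C * ((eLpNorm (G (k + 1)) γ volume).toReal ^ q +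
            (eLpNorm (G (k + 2)) γ volume).toReal ^ q) * a := by
        rw [hN₁R, hN₂R]

end Estimate

section Criterion

/-- In `Fin 3`, `k + 1 ≠ k`. [folklore] -/
private theorem fin3_add_one_ne_vg (k : Fin 3) : k + 1 ≠ k := by
  fin_cases k <;> decide

/-- In `Fin 3`, `k + 2 ≠ k`. [folklore] -/
private theorem fin3_add_two_ne_vg (k : Fin 3) : k + 2 ≠ k := by
  fin_cases k <;> decide

/-- `(P_k y)_j = y_j` for `j ≠ k`. [folklore] -/
private theorem dropC_apply_apply_of_ne (y : EuclideanSpace ℝ (Fin 3)) {j k : Fin 3} (hj : j ≠ k) :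
    (ContinuousLinearMap.id ℝ (EuclideanSpace ℝ (Fin 3)) - ContinuousLinearMap.smulRight (EuclideanSpace.proj k : EuclideanSpace ℝ (Fin 3) →L[ℝ] ℝ) (EuclideanSpace.basisFun (Fin 3) ℝ k : EuclideanSpace ℝ (Fin 3))) y j = y j := by
  fin_cases k <;> fin_cases j <;> simp_all [EuclideanSpace.basisFun_apply]

/-- `|y_j| ≤ ‖P_k y‖` for `j ≠ k`. [folklore] -/
private theorem abs_apply_le_norm_dropC (y : EuclideanSpace ℝ (Fin 3)) {j k : Fin 3} (hj : j ≠ k) :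
    |y j| ≤ ‖(ContinuousLinearMap.id ℝ (EuclideanSpace ℝ (Fin 3)) - ContinuousLinearMap.smulRight (EuclideanSpace.proj k : EuclideanSpace ℝ (Fin 3) →L[ℝ] ℝ) (EuclideanSpace.basisFun (Fin 3) ℝ k : EuclideanSpace ℝ (Fin 3))) y‖ := by
  rw [← dropC_apply_apply_of_ne y hj]
  exact abs_apply_le_norm_vg _ j

/-- **Exponent bookkeeping for Thm. 2**: in `ℝ≥0∞`, if `3 < γ < ∞` and `2/α + 3/γ = 1` then
`0 < α < ∞` and `α.toReal = 2γ/(γ − 3)`. [cite: ChaeChoe1999, Thm. 2 (p. 2)] -/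
private theorem vg_exponents {α γ : ℝ≥0∞} (hγ : 3 < γ) (hγtop : γ ≠ ⊤) (hαγ : 2 / α + 3 / γ = 1) :
    α ≠ 0 ∧ α ≠ ⊤ ∧ α.toReal = 2 * γ.toReal / (γ.toReal - 3) := by
  have hγ0 : γ ≠ 0 := (lt_trans (by norm_num) hγ).ne'
  have hρ3 : 3 < γ.toReal := toReal_three_lt hγ hγtop
  have hρ0 : 0 < γ.toReal := by linarith
  have hα0 : α ≠ 0 := by
    rintro rfl
    rw [ENNReal.div_zero (by norm_num : (2 : ℝ≥0∞) ≠ 0), top_add] at hαγ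
    exact absurd hαγ ENNReal.top_ne_one
  have h2α : 2 / α ≠ ⊤ := ENNReal.div_ne_top (by norm_num) hα0
  have h3γ : 3 / γ ≠ ⊤ := ENNReal.div_ne_top (by norm_num) hγ0
  have hreal : 2 / α.toReal + 3 / γ.toReal = 1 := by
    have h := congrArg ENNReal.toReal hαγ
    rw [ENNReal.toReal_add h2α h3γ, ENNReal.toReal_div, ENNReal.toReal_div, ENNReal.toReal_ofNat,
      ENNReal.toReal_ofNat] at h
    simpa using h
  have hαtop : α ≠ ⊤ := by
    intro hα
    rw [hα, ENNReal.toReal_top, div_zero, zero_add, div_eq_one_iff_eq hρ0.ne'] at hreal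
    linarith
  have ha0 : 0 < α.toReal := ENNReal.toReal_pos hα0 hαtop
  refine ⟨hα0, hαtop, ?_⟩
  have hρ3' : 0 < γ.toReal - 3 := by linarith
  have h : 2 / α.toReal = (γ.toReal - 3) / γ.toReal := by
    rw [sub_div, div_self hρ0.ne']; linarith
  have h' : α.toReal = 2 / ((γ.toReal - 3) / γ.toReal) := by
    rw [← h]; field_simp
  rw [h', div_div_eq_mul_div]

/-- `L^q_t L^r_x` data: the lower time integral of `‖G(t)‖_{L^r}^{q}` (real exponent `q.toReal`)
is finite and `G(t) ∈ L^r` for a.e. `t` (unfolding `MemLqLp`). [folklore] -/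
private theorem lintegral_ofReal_toReal_rpow_lt_top {X F : Type*} [MeasureSpace X] [NormedAddCommGroup F]
    {q r : ℝ≥0∞} {G : ℝ → X → F} {T : ℝ} (hq0 : q ≠ 0) (hqtop : q ≠ ⊤)
    (hS : MemLqLp q r G (Ioo 0 T)) :
    (∫⁻ t in Ioo 0 T, ENNReal.ofReal ((eLpNorm (G t) r volume).toReal ^ q.toReal) < ⊤) ∧
    ∀ᵐ t ∂volume, t ∈ Ioo 0 T → eLpNorm (G t) r volume < ⊤ := by
  set N : ℝ → ℝ := fun t => (eLpNorm (G t) r volume).toReal with hN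
  have hN0 : ∀ t, 0 ≤ N t := fun t => ENNReal.toReal_nonneg
  refine ⟨?_, ?_⟩
  · have hlt : ∫⁻ t, ‖N t‖ₑ ^ q.toReal ∂(volume.restrict (Ioo 0 T)) < ⊤ :=
      lintegral_rpow_enorm_lt_top_of_eLpNorm_lt_top hq0 hqtop hS.2
    refine lt_of_le_of_lt (le_of_eq (lintegral_congr fun t => ?_)) hlt
    rw [Real.enorm_eq_ofReal (hN0 t), ENNReal.ofReal_rpow_of_nonneg (hN0 t) ENNReal.toReal_nonneg]
  · have h := hS.1
    rw [ae_restrict_iff' measurableSet_Ioo] at h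
    filter_upwards [h] with t ht htI
    exact (ht htI).eLpNorm_lt_top

/-- **Two vorticity components bounded in `L²` give continuation** (the last step of the proof
of Chae–Choe 1999, Thm. 2: "`ω̃ ∈ L^∞(0,T;L²(ℝ³)) ∩ L²(0,T;H¹(ℝ³))`, which implies the regularity
of `v` as previously", i.e. by Thm. 1 with `α = ∞`, `γ = 2`, `2/α + 3/γ = 3/2 ≤ 2`). For a
classical unforced solution on `ℝ³ × [0, T)` in the Beale–Kato–Majda class on every `[0, T'']`,
`T'' < T`: if `∫|ω_j(t)|² ≤ M` for all `t ∈ (0, T)` and `j ≠ k`, then `HasSobolevExtensionPast ν u T`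
(`chaeChoe_two_vorticity_components_criterion_of_le`). [cite: ChaeChoe1999, proof of Thm. 2 (p. 6) with Thm. 1] -/
theorem hasSobolevExtensionPast_of_two_vorticity_components_bounded {ν : ℝ} (hν : 0 < ν) {T : ℝ}
    (hT : 0 < T)
    {u : ℝ → (EuclideanSpace ℝ (Fin 3)) → (EuclideanSpace ℝ (Fin 3))}
    {p : ℝ → (EuclideanSpace ℝ (Fin 3)) → ℝ}
    (hsol : IsClassicalNSSolutionOn (Ico 0 T) ν 0 u p)
    (hreg : ∀ T'' < T, HasBoundedSobolevNormsOn (Icc 0 T'') u) (k : Fin 3) {M : ℝ}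
    (hM : ∀ j, j ≠ k → ∀ t ∈ Ioo 0 T, ∫⁻ x, ‖curl (u t) x j‖ₑ ^ 2 ≤ ENNReal.ofReal M) :
    HasSobolevExtensionPast ν u T := by
  have h1 : (1 : ℝ≥0∞) < ⊤ := ENNReal.one_lt_top
  have h32 : (3 : ℝ≥0∞) / 2 < 2 := by
    rw [ENNReal.div_lt_iff (Or.inl two_ne_zero) (Or.inl ENNReal.ofNat_ne_top)]; norm_num
  have h2top : (2 : ℝ≥0∞) < ⊤ := ENNReal.ofNat_lt_top
  have hle : 2 / (⊤ : ℝ≥0∞) + 3 / 2 ≤ 2 := by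
    rw [ENNReal.div_top, zero_add]; exact ENNReal.div_le_of_le_mul (by norm_num)
  refine chaeChoe_two_vorticity_components_criterion_of_le hν hT hsol hreg h1 h32 h2top hle k ?_
  intro j hj
  -- the bound in `L^∞_t L²_x`
  set Cb : ℝ≥0∞ := (ENNReal.ofReal M) ^ (2 : ℝ)⁻¹ with hCb
  have hCbtop : Cb ≠ ⊤ := ENNReal.rpow_ne_top_of_nonneg (by norm_num) ENNReal.ofReal_ne_top
  have hslice : ∀ t ∈ Ioo 0 T, eLpNorm (fun x => curl (u t) x j) 2 volume ≤ Cb := by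
    intro t ht
    rw [hCb, ENNReal.le_rpow_inv_iff two_pos, ENNReal.rpow_two, ← lintegral_enorm_sq_eq_eLpNorm_two_sq]
    exact hM j hj t ht
  have hcont : ∀ t ∈ Ioo 0 T, Continuous fun x => curl (u t) x j := fun t ht =>
    (EuclideanSpace.proj j).continuous.comp
      (continuous_curl ((hsol.contDiff_velocity (Ioo_subset_Ico_self ht)).of_le (by norm_cast)))
  refine ⟨?_, ?_⟩
  · rw [ae_restrict_iff' measurableSet_Ioo]
    refine Eventually.of_forall fun t ht => ⟨(hcont t ht).aestronglyMeasurable, ?_⟩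
    exact (hslice t ht).trans_lt hCbtop.lt_top
  · rw [eLqLpNorm_def, eLpNorm_exponent_top]
    refine eLpNormEssSup_lt_top_of_ae_bound (C := Cb.toReal) ?_
    rw [ae_restrict_iff' measurableSet_Ioo]
    refine Eventually.of_forall fun t ht => ?_
    rw [Real.norm_of_nonneg ENNReal.toReal_nonneg]
    exact ENNReal.toReal_mono hCbtop (hslice t ht)

set_option maxHeartbeats 1600000 in
/-- **The a priori bound for two vorticity components under Chae–Choe's hypothesis on the
gradients of two velocity components** (Chae–Choe 1999, proof of Thm. 2: (12), (13), Grönwall ⇒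
`sup_{0≤t≤T} ‖ω̃(t)‖²₂ + ν∫‖∇ω̃‖² ≤ C`). Let `ν > 0`, `T > 0`, `(u, p)` a classical unforced
Navier–Stokes solution on `ℝ³ × [0, T)` with all `L²` Sobolev seminorms bounded on every
`[0, T'']`, `T'' < T`. If for an index `k` the gradients of the two other velocity components
satisfy `∇u_j ∈ L^α(0,T; L^γ)`, `j ≠ k`, with `2/α + 3/γ = 1`, `3 < γ < ∞`, then
`∫|ω_j(t)|²`, `j ≠ k`, is bounded on `[0, T)`. Proof: on each slab `[0, T'']` the estimate
`exists_two_mul_integral_proj_stretching_le` at a.e. time (where `∇u_j(t) ∈ L^γ`), the slab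
Grönwall bound `integral_sq_norm_clm_curl_le_of_weight_slab_ae` with the weight
`C(‖∇u_{k+1}(t)‖_γ^α + ‖∇u_{k+2}(t)‖_γ^α)` (integrable, uniformly in `T''`) and the enstrophy
forcing `∫₀^{T''}∫|ω|² ≤ ‖curl‖² C_E ‖u₀‖²₂/ν` (Tao's energy class: the dissipation bound), and
`|ω_j| ≤ |P_kω|`. [cite: ChaeChoe1999, Thm. 2 and proof, (12)–(13) (pp. 2, 5–6); Tao2011, Lemma 8.1] -/
theorem exists_uniform_sq_norm_two_vorticity_components_bound {ν T : ℝ} (hν : 0 < ν) (hT : 0 < T)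
    {u : ℝ → (EuclideanSpace ℝ (Fin 3)) → (EuclideanSpace ℝ (Fin 3))}
    {p : ℝ → (EuclideanSpace ℝ (Fin 3)) → ℝ}
    (hsol : IsClassicalNSSolutionOn (Ico 0 T) ν 0 u p)
    (hreg : ∀ T'' < T, HasBoundedSobolevNormsOn (Icc 0 T'') u)
    {α γ : ℝ≥0∞} (hγ : 3 < γ) (hγtop : γ < ⊤) (hαγ : 2 / α + 3 / γ = 1) (k : Fin 3)
    (hG : ∀ j, j ≠ k → MemLqLp α γ
      (fun t x => (EuclideanSpace.proj j : EuclideanSpace ℝ (Fin 3) →L[ℝ] ℝ).comp (fderiv ℝ (u t) x))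
      (Ioo 0 T)) :
    ∃ M : ℝ, 0 ≤ M ∧ ∀ j, j ≠ k → ∀ t ∈ Ico 0 T,
      ∫⁻ x, ‖curl (u t) x j‖ₑ ^ 2 ≤ ENNReal.ofReal M := by
  obtain ⟨Ce, hCetop, hTao⟩ := tao_finite_energy_smooth_energy_bound_holds
  -- exponents and the stretching constant
  have hγtop' : γ ≠ ⊤ := hγtop.ne
  have hγ0 : γ ≠ 0 := (lt_trans (by norm_num) hγ).ne'
  obtain ⟨hα0, hαtop, hαq⟩ := vg_exponents hγ hγtop' hαγ
  set q : ℝ := 2 * γ.toReal / (γ.toReal - 3) with hq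
  have hq0 : 0 ≤ q := by rw [← hαq]; exact ENNReal.toReal_nonneg
  obtain ⟨C, hC0, hstrC⟩ := exists_two_mul_integral_proj_stretching_le hγ hγtop' hν k
  -- the component gradients and their time weights
  set Gr : Fin 3 → ℝ → EuclideanSpace ℝ (Fin 3) → (EuclideanSpace ℝ (Fin 3) →L[ℝ] ℝ) :=
    fun j t x => (EuclideanSpace.proj j : EuclideanSpace ℝ (Fin 3) →L[ℝ] ℝ).comp (fderiv ℝ (u t) x)
    with hGr
  set N : Fin 3 → ℝ → ℝ := fun j t => (eLpNorm (Gr j t) γ volume).toReal with hN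
  have hN0 : ∀ j t, 0 ≤ N j t := fun j t => ENNReal.toReal_nonneg
  obtain ⟨hI1, hae1⟩ := lintegral_ofReal_toReal_rpow_lt_top hα0 hαtop (hG (k + 1) (fin3_add_one_ne_vg k))
  obtain ⟨hI2, hae2⟩ := lintegral_ofReal_toReal_rpow_lt_top hα0 hαtop (hG (k + 2) (fin3_add_two_ne_vg k))
  rw [hαq] at hI1 hI2
  set I₁ : ℝ≥0∞ := ∫⁻ t in Ioo 0 T, ENNReal.ofReal (N (k + 1) t ^ q) with hI₁
  set I₂ : ℝ≥0∞ := ∫⁻ t in Ioo 0 T, ENNReal.ofReal (N (k + 2) t ^ q) with hI₂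
  have hI₁top : I₁ < ⊤ := hI1
  have hI₂top : I₂ < ⊤ := hI2
  set a : ℝ → ℝ := fun t => C * (N (k + 1) t ^ q + N (k + 2) t ^ q) with ha
  have ha0 : ∀ t, 0 ≤ a t := fun t => by positivity
  set Aw : ℝ := C * (I₁ + I₂).toReal with hAw
  have hAw0 : 0 ≤ Aw := by positivity
  have haE : ∀ t, ENNReal.ofReal (a t) =
      ENNReal.ofReal C * (ENNReal.ofReal (N (k + 1) t ^ q) + ENNReal.ofReal (N (k + 2) t ^ q)) := by
    intro t
    rw [ha]; dsimp only
    rw [ENNReal.ofReal_mul hC0, ENNReal.ofReal_add (by positivity) (by positivity)]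
  -- measurability in time of the weights (joint continuity of `∇u` on `(0,T) × ℝ³` and Tonelli)
  have hD : IsSmoothSpaceTimeOn (Ico 0 T) (fun t x => fderiv ℝ (u t) x) :=
    hsol.smooth_velocity.fderiv_slice (uniqueDiffOn_Ico 0 T)
  have hcD : ContinuousOn (fun z : ℝ × EuclideanSpace ℝ (Fin 3) => fderiv ℝ (u z.1) z.2)
      (Ioo 0 T ×ˢ univ) :=
    hD.continuousOn.mono (prod_mono Ioo_subset_Ico_self Subset.rfl)
  have hmeasD : AEStronglyMeasurable (fun z : ℝ × EuclideanSpace ℝ (Fin 3) => fderiv ℝ (u z.1) z.2)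
      ((volume.restrict (Ioo 0 T)).prod volume) := by
    rw [Measure.restrict_prod_eq_prod_univ]
    exact hcD.aestronglyMeasurable (measurableSet_Ioo.prod MeasurableSet.univ)
  have hNmeas : ∀ j, AEMeasurable (fun t => ENNReal.ofReal (N j t ^ q)) (volume.restrict (Ioo 0 T)) := by
    intro j
    have hcj : Continuous fun L : EuclideanSpace ℝ (Fin 3) →L[ℝ] EuclideanSpace ℝ (Fin 3) =>
        (EuclideanSpace.proj j : EuclideanSpace ℝ (Fin 3) →L[ℝ] ℝ).comp L :=
      continuous_const.clm_comp continuous_id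
    have hmj : AEStronglyMeasurable (fun z : ℝ × EuclideanSpace ℝ (Fin 3) => Gr j z.1 z.2)
        ((volume.restrict (Ioo 0 T)).prod volume) := hcj.comp_aestronglyMeasurable hmeasD
    have hGI : AEMeasurable (fun t => ∫⁻ x, ‖Gr j t x‖ₑ ^ γ.toReal) (volume.restrict (Ioo 0 T)) :=
      (hmj.enorm.pow_const _).lintegral_prod_right'
    have hE : AEMeasurable (fun t => eLpNorm (Gr j t) γ volume) (volume.restrict (Ioo 0 T)) := by
      have heq : (fun t => eLpNorm (Gr j t) γ volume) =
          fun t => (∫⁻ x, ‖Gr j t x‖ₑ ^ γ.toReal) ^ (1 / γ.toReal) :=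
        funext fun t => eLpNorm_eq_lintegral_rpow_enorm_toReal hγ0 hγtop'
      rw [heq]
      exact hGI.pow_const _
    have hNj : AEMeasurable (N j) (volume.restrict (Ioo 0 T)) :=
      ENNReal.measurable_toReal.comp_aemeasurable hE
    exact ENNReal.measurable_ofReal.comp_aemeasurable (hNj.pow_const q)
  have hAint : ∀ T'' ≤ T, ∫⁻ t in Ioo 0 T'', ENNReal.ofReal (a t) ≤ ENNReal.ofReal Aw := by
    intro T'' hT''
    have hCtop : ENNReal.ofReal C ≠ ⊤ := ENNReal.ofReal_ne_top
    calc ∫⁻ t in Ioo 0 T'', ENNReal.ofReal (a t)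
        ≤ ∫⁻ t in Ioo 0 T, ENNReal.ofReal (a t) := lintegral_mono_set (Ioo_subset_Ioo le_rfl hT'')
      _ = ∫⁻ t in Ioo 0 T, ENNReal.ofReal C *
            (ENNReal.ofReal (N (k + 1) t ^ q) + ENNReal.ofReal (N (k + 2) t ^ q)) :=
          lintegral_congr fun t => haE t
      _ = ENNReal.ofReal C * (I₁ + I₂) := by
          rw [lintegral_const_mul' _ _ hCtop, lintegral_add_left' (hNmeas (k + 1))]
      _ = ENNReal.ofReal Aw := by
          rw [hAw, ENNReal.ofReal_mul hC0, ENNReal.ofReal_toReal]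
          exact (ENNReal.add_lt_top.2 ⟨hI₁top, hI₂top⟩).ne
  -- a.e. finiteness of the two component gradients in `L^γ`
  have hae1' : ∀ᵐ s ∂volume, s ∈ Ioo 0 T → eLpNorm (Gr (k + 1) s) γ volume < ⊤ := hae1
  have hae2' : ∀ᵐ s ∂volume, s ∈ Ioo 0 T → eLpNorm (Gr (k + 2) s) γ volume < ⊤ := hae2
  -- the initial energy and the dissipation budget
  have hreg0 : HasBoundedSobolevNormsOn (Icc 0 (T / 2)) u := hreg (T / 2) (by linarith)
  have h00 : (0 : ℝ) ∈ Icc 0 (T / 2) := ⟨le_rfl, by linarith⟩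
  set E₀ : ℝ≥0∞ := ∫⁻ x, ‖u 0 x‖ₑ ^ 2 with hE₀
  have hE₀top : E₀ < ⊤ := by
    obtain ⟨C0, hC0'⟩ := hreg0 0
    refine lt_of_le_of_lt (le_of_eq (lintegral_congr fun x => ?_)) ((hC0' 0 h00).trans_lt ENNReal.coe_lt_top)
    rw [← ofReal_norm, ← ofReal_norm, norm_iteratedFDeriv_zero]
  set κ : ℝ := ‖curlCLM‖ with hκ
  have hν0 : ENNReal.ofReal ν ≠ 0 := (ENNReal.ofReal_pos.2 hν).ne'
  set E₁E : ℝ≥0∞ := ENNReal.ofReal (κ ^ 2) * (Ce * E₀ / ENNReal.ofReal ν) with hE₁E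
  have hE₁Etop : E₁E < ⊤ := ENNReal.mul_lt_top ENNReal.ofReal_lt_top
    (ENNReal.div_lt_top (ENNReal.mul_ne_top hCetop.ne hE₀top.ne) hν0)
  set E₁ : ℝ := E₁E.toReal with hE₁
  have hE₁0 : 0 ≤ E₁ := ENNReal.toReal_nonneg
  have hE₁of : ENNReal.ofReal E₁ = E₁E := ENNReal.ofReal_toReal hE₁Etop.ne
  -- the initial two-component enstrophy
  set Y₀ : ℝ := ∫ x, ‖(ContinuousLinearMap.id ℝ (EuclideanSpace ℝ (Fin 3)) - ContinuousLinearMap.smulRight (EuclideanSpace.proj k : EuclideanSpace ℝ (Fin 3) →L[ℝ] ℝ) (EuclideanSpace.basisFun (Fin 3) ℝ k : EuclideanSpace ℝ (Fin 3))) (curl (u 0) x)‖ ^ 2 with hY₀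
  have hY₀0 : 0 ≤ Y₀ := integral_nonneg fun x => sq_nonneg _
  set M : ℝ := (Y₀ + 1 * E₁) * Real.exp Aw with hM
  have hM0 : 0 ≤ M := by positivity
  refine ⟨M, hM0, ?_⟩
  intro j hj t ht
  -- a closed slab containing `t`
  set T'' : ℝ := (t + T) / 2 with hT''def
  have htT'' : t < T'' := by rw [hT''def]; linarith [ht.2]
  have hT''T : T'' < T := by rw [hT''def]; linarith [ht.2]
  have hT''pos : 0 < T'' := lt_of_le_of_lt ht.1 htT''
  have hS : IsClassicalNSSolutionOn (Icc 0 T'') ν 0 u p :=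
    hsol.mono (Icc_subset_Ico_right hT''T) (uniqueDiffOn_Icc hT''pos)
  have hB : HasBoundedSobolevNormsOn (Icc 0 T'') u := hreg T'' hT''T
  have htS : t ∈ Icc 0 T'' := ⟨ht.1, htT''.le⟩
  have hsm : ∀ s ∈ Icc 0 T'', ContDiff ℝ ∞ (u s) := fun s hs => hS.contDiff_velocity hs
  have hsm3 : ∀ s ∈ Icc 0 T'', ContDiff ℝ 3 (u s) := fun s hs => (hsm s hs).of_le (by norm_cast)
  have hfin : ∀ n, ∀ s ∈ Icc 0 T'', ∫⁻ x, ‖iteratedFDeriv ℝ n (u s) x‖ₑ ^ 2 < ⊤ := fun n s hs => by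
    obtain ⟨Cn, hCn⟩ := hB n
    exact (hCn s hs).trans_lt ENNReal.coe_lt_top
  obtain ⟨B₁, hB₁0, hB₁⟩ := exists_forall_norm_fderiv_le_of_hasBoundedSobolevNormsOn hsm3 hB
  -- Tao's energy class on the slab: the dissipation budget
  have hfe : ∃ A : ℝ≥0∞, A < ⊤ ∧ ∀ s ∈ Icc 0 T'', ∫⁻ x, ‖u s x‖ₑ ^ 2 ≤ A := by
    obtain ⟨C0, hC0'⟩ := hB 0
    refine ⟨C0, ENNReal.coe_lt_top, fun s hs => ?_⟩
    refine le_trans (le_of_eq (lintegral_congr fun x => ?_)) (hC0' s hs)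
    rw [← ofReal_norm, ← ofReal_norm, norm_iteratedFDeriv_zero]
  obtain ⟨-, hdis⟩ := hTao ν T'' hν hT''pos u p hS hfe
  have hdis' : ∫⁻ s in Ioo 0 T'', ∫⁻ x, ENNReal.ofReal (frobeniusNormSq (fderiv ℝ (u s) x)) ≤
      Ce * E₀ / ENNReal.ofReal ν := by
    rw [ENNReal.le_div_iff_mul_le (Or.inl hν0) (Or.inl ENNReal.ofReal_ne_top), mul_comm]
    exact hdis
  have hE₁slab : ∫⁻ s in Ioo 0 T'', ENNReal.ofReal (∫ x, ‖curl (u s) x‖ ^ 2) ≤ ENNReal.ofReal E₁ := by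
    rw [hE₁of, hE₁E]
    have hpt : ∀ s ∈ Ioo 0 T'', ENNReal.ofReal (∫ x, ‖curl (u s) x‖ ^ 2) ≤
        ENNReal.ofReal (κ ^ 2) * ∫⁻ x, ENNReal.ofReal (frobeniusNormSq (fderiv ℝ (u s) x)) := by
      intro s hs
      have hsS : s ∈ Icc 0 T'' := ⟨hs.1.le, hs.2.le⟩
      have hωc : Continuous (curl (u s)) := continuous_curl ((hsm s hsS).of_le (by norm_cast))
      have hi : Integrable fun x => ‖curl (u s) x‖ ^ 2 := by
        refine integrable_sq_norm_of_lintegral_lt_top hωc ?_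
        exact lt_of_le_of_lt (lintegral_curl_sq_le (u s))
          (ENNReal.mul_lt_top ENNReal.ofReal_lt_top (hfin 1 s hsS))
      rw [ofReal_integral_eq_lintegral_ofReal hi (Eventually.of_forall fun x => sq_nonneg _)]
      have h1 : ∫⁻ x, ENNReal.ofReal (‖curl (u s) x‖ ^ 2) = ∫⁻ x, ‖curl (u s) x‖ₑ ^ 2 :=
        lintegral_congr fun x => by rw [← ofReal_norm, ENNReal.ofReal_pow (norm_nonneg _)]
      rw [h1]
      refine (lintegral_curl_sq_le (u s)).trans (mul_le_mul' le_rfl (lintegral_mono fun x => ?_))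
      rw [← ofReal_norm, norm_iteratedFDeriv_one (u s), ← ENNReal.ofReal_pow (norm_nonneg _)]
      exact ENNReal.ofReal_le_ofReal (sq_opNorm_le_frobeniusNormSq _)
    calc ∫⁻ s in Ioo 0 T'', ENNReal.ofReal (∫ x, ‖curl (u s) x‖ ^ 2)
        ≤ ∫⁻ s in Ioo 0 T'', ENNReal.ofReal (κ ^ 2) *
            ∫⁻ x, ENNReal.ofReal (frobeniusNormSq (fderiv ℝ (u s) x)) := setLIntegral_mono' measurableSet_Ioo hpt
      _ = ENNReal.ofReal (κ ^ 2) *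
            ∫⁻ s in Ioo 0 T'', ∫⁻ x, ENNReal.ofReal (frobeniusNormSq (fderiv ℝ (u s) x)) :=
          lintegral_const_mul' _ _ ENNReal.ofReal_ne_top
      _ ≤ ENNReal.ofReal (κ ^ 2) * (Ce * E₀ / ENNReal.ofReal ν) := mul_le_mul' le_rfl hdis'
  -- the stretching estimate at a.e. time of the slab
  have hstrS : ∀ᵐ s ∂(volume.restrict (Ioo 0 T'')),
      2 * ∫ x, ⟪(ContinuousLinearMap.id ℝ (EuclideanSpace ℝ (Fin 3)) - ContinuousLinearMap.smulRight (EuclideanSpace.proj k : EuclideanSpace ℝ (Fin 3) →L[ℝ] ℝ) (EuclideanSpace.basisFun (Fin 3) ℝ k : EuclideanSpace ℝ (Fin 3))) (curl (u s) x), (ContinuousLinearMap.id ℝ (EuclideanSpace ℝ (Fin 3)) - ContinuousLinearMap.smulRight (EuclideanSpace.proj k : EuclideanSpace ℝ (Fin 3) →L[ℝ] ℝ) (EuclideanSpace.basisFun (Fin 3) ℝ k : EuclideanSpace ℝ (Fin 3))) (fderiv ℝ (u s) x (curl (u s) x))⟫ ≤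
        ν * (∫ x, frobeniusNormSq (fderiv ℝ (fun y => (ContinuousLinearMap.id ℝ (EuclideanSpace ℝ (Fin 3)) - ContinuousLinearMap.smulRight (EuclideanSpace.proj k : EuclideanSpace ℝ (Fin 3) →L[ℝ] ℝ) (EuclideanSpace.basisFun (Fin 3) ℝ k : EuclideanSpace ℝ (Fin 3))) (curl (u s) y)) x)) +
          1 * (∫ x, ‖curl (u s) x‖ ^ 2) + a s * (∫ x, ‖(ContinuousLinearMap.id ℝ (EuclideanSpace ℝ (Fin 3)) - ContinuousLinearMap.smulRight (EuclideanSpace.proj k : EuclideanSpace ℝ (Fin 3) →L[ℝ] ℝ) (EuclideanSpace.basisFun (Fin 3) ℝ k : EuclideanSpace ℝ (Fin 3))) (curl (u s) x)‖ ^ 2) := by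
    rw [ae_restrict_iff' measurableSet_Ioo]
    filter_upwards [hae1', hae2'] with s h1 h2 hsI
    have hsT : s ∈ Ioo 0 T := ⟨hsI.1, hsI.2.trans hT''T⟩
    have hsS : s ∈ Icc 0 T'' := ⟨hsI.1.le, hsI.2.le⟩
    have h := hstrC (u s) (hsm s hsS) (hB₁ s hsS) (hfin 1 s hsS) (hfin 2 s hsS) (h1 hsT) (h2 hsT)
    rw [one_mul]
    exact h
  -- the slab bound for `∫|P_k ω|²`
  have hY := integral_sq_norm_clm_curl_le_of_weight_slab_ae hν hT''pos hS hB (ContinuousLinearMap.id ℝ (EuclideanSpace ℝ (Fin 3)) - ContinuousLinearMap.smulRight (EuclideanSpace.proj k : EuclideanSpace ℝ (Fin 3) →L[ℝ] ℝ) (EuclideanSpace.basisFun (Fin 3) ℝ k : EuclideanSpace ℝ (Fin 3))) ha0 hAw0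
    (hAint T'' hT''T.le) zero_le_one hE₁0 hE₁slab hstrS t htS
  -- `∫|ω_j|² ≤ ∫|P_k ω|²`
  have hvt : ContDiff ℝ ∞ (u t) := hS.contDiff_velocity htS
  have hωc : Continuous (curl (u t)) := continuous_curl (hvt.of_le (by norm_cast))
  have hPc : Continuous fun x => (ContinuousLinearMap.id ℝ (EuclideanSpace ℝ (Fin 3)) - ContinuousLinearMap.smulRight (EuclideanSpace.proj k : EuclideanSpace ℝ (Fin 3) →L[ℝ] ℝ) (EuclideanSpace.basisFun (Fin 3) ℝ k : EuclideanSpace ℝ (Fin 3))) (curl (u t) x) :=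
    (ContinuousLinearMap.continuous _).comp hωc
  have l2ω : ∫⁻ x, ‖curl (u t) x‖ₑ ^ 2 < ⊤ :=
    lt_of_le_of_lt (lintegral_curl_sq_le (u t)) (ENNReal.mul_lt_top ENNReal.ofReal_lt_top (hfin 1 t htS))
  have l2P : ∫⁻ x, ‖(ContinuousLinearMap.id ℝ (EuclideanSpace ℝ (Fin 3)) - ContinuousLinearMap.smulRight (EuclideanSpace.proj k : EuclideanSpace ℝ (Fin 3) →L[ℝ] ℝ) (EuclideanSpace.basisFun (Fin 3) ℝ k : EuclideanSpace ℝ (Fin 3))) (curl (u t) x)‖ₑ ^ 2 < ⊤ := by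
    refine lintegral_enorm_sq_lt_top_of_norm_le (fun x => ?_) (lintegral_enorm_sq_const_smul_lt_top (2 : ℝ) l2ω)
    rw [norm_smul, Real.norm_of_nonneg (by norm_num : (0 : ℝ) ≤ 2)]
    exact norm_dropC_apply_le_two_mul _ k
  have hiP : Integrable fun x => ‖(ContinuousLinearMap.id ℝ (EuclideanSpace ℝ (Fin 3)) - ContinuousLinearMap.smulRight (EuclideanSpace.proj k : EuclideanSpace ℝ (Fin 3) →L[ℝ] ℝ) (EuclideanSpace.basisFun (Fin 3) ℝ k : EuclideanSpace ℝ (Fin 3))) (curl (u t) x)‖ ^ 2 :=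
    integrable_sq_norm_of_lintegral_lt_top hPc l2P
  calc ∫⁻ x, ‖curl (u t) x j‖ₑ ^ 2 ≤ ∫⁻ x, ‖(ContinuousLinearMap.id ℝ (EuclideanSpace ℝ (Fin 3)) - ContinuousLinearMap.smulRight (EuclideanSpace.proj k : EuclideanSpace ℝ (Fin 3) →L[ℝ] ℝ) (EuclideanSpace.basisFun (Fin 3) ℝ k : EuclideanSpace ℝ (Fin 3))) (curl (u t) x)‖ₑ ^ 2 := by
        refine lintegral_mono fun x => ?_
        gcongr
        rw [← ofReal_norm, ← ofReal_norm, Real.norm_eq_abs]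
        exact ENNReal.ofReal_le_ofReal (abs_apply_le_norm_dropC _ hj)
    _ = ENNReal.ofReal (∫ x, ‖(ContinuousLinearMap.id ℝ (EuclideanSpace ℝ (Fin 3)) - ContinuousLinearMap.smulRight (EuclideanSpace.proj k : EuclideanSpace ℝ (Fin 3) →L[ℝ] ℝ) (EuclideanSpace.basisFun (Fin 3) ℝ k : EuclideanSpace ℝ (Fin 3))) (curl (u t) x)‖ ^ 2) := by
        rw [ofReal_integral_eq_lintegral_ofReal hiP (Eventually.of_forall fun x => sq_nonneg _)]
        exact lintegral_congr fun x => by rw [← ofReal_norm, ENNReal.ofReal_pow (norm_nonneg _)]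
    _ ≤ ENNReal.ofReal M := ENNReal.ofReal_le_ofReal hY

/-- **Chae–Choe's second criterion: the gradients of two velocity components**
(Chae–Choe 1999, Thm. 2, in the rendering of the tree's `constantin_fefferman`, ns.S27). Let
`ν > 0`, `T > 0`, and let `(u, p)` be a classical unforced Navier–Stokes solution on
`ℝ³ × [0, T)` in the Beale–Kato–Majda class on every compact `[0, T''] ⊆ [0, T)`. If for some
index `k` the gradients `∇u_j = e_j^* ∘ ∇u` of the two OTHER velocity components, `j ≠ k`,
belong to `L^α(0,T; L^γ(ℝ³))` with `2/α + 3/γ = 1`, `3 < γ < ∞` (`⇔ 2 < α < ∞`), then the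
solution continues in the class past `T` (`HasSobolevExtensionPast ν u T`). Printed: Leray–Hopf
weak solution with `v₀ ∈ H¹`, `Dṽ ∈ L^{α,γ}_T`, `ṽ = v₁e₁ + v₂e₂`, `2/α + 3/γ ≤ 1`,
`2 ≤ α ≤ ∞`, `3 ≤ γ ≤ ∞` ⇒ classical on `(0,T]`; the endpoint exponents and the strict
inequality are not covered here. Proof: `exists_uniform_sq_norm_two_vorticity_components_bound`
and `hasSobolevExtensionPast_of_two_vorticity_components_bounded` (Thm. 1).
[cite: ChaeChoe1999, Thm. 2 (p. 2) and proof (pp. 5–6)] -/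
theorem chaeChoe_two_velocity_gradients_criterion {ν : ℝ} (hν : 0 < ν) {T : ℝ} (hT : 0 < T)
    {u : ℝ → (EuclideanSpace ℝ (Fin 3)) → (EuclideanSpace ℝ (Fin 3))}
    {p : ℝ → (EuclideanSpace ℝ (Fin 3)) → ℝ}
    (hsol : IsClassicalNSSolutionOn (Ico 0 T) ν 0 u p)
    (hreg : ∀ T'' < T, HasBoundedSobolevNormsOn (Icc 0 T'') u)
    {α γ : ℝ≥0∞} (hγ : 3 < γ) (hγtop : γ < ⊤) (hαγ : 2 / α + 3 / γ = 1) (k : Fin 3)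
    (hG : ∀ j, j ≠ k → MemLqLp α γ
      (fun t x => (EuclideanSpace.proj j : EuclideanSpace ℝ (Fin 3) →L[ℝ] ℝ).comp (fderiv ℝ (u t) x))
      (Ioo 0 T)) :
    HasSobolevExtensionPast ν u T := by
  obtain ⟨M, -, hM⟩ :=
    exists_uniform_sq_norm_two_vorticity_components_bound hν hT hsol hreg hγ hγtop hαγ k hG
  exact hasSobolevExtensionPast_of_two_vorticity_components_bounded hν hT hsol hreg k
    (fun j hj t ht => hM j hj t (Ioo_subset_Ico_self ht))

/-! ### The printed hypothesis `2/α + 3/γ ≤ 1` (Hölder's inequality in time) -/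

/-- Time measurability of the `L^γ` norms of the component gradients `∇u_j(t) = e_j^* ∘ ∇u(t)`
of a classical solution on `(0, T)`, `0 < γ < ∞` (joint continuity of `∇u` on `(0,T) × ℝ³` and
Tonelli). [folklore] -/
private theorem aemeasurable_eLpNorm_proj_fderiv {ν T : ℝ}
    {u : ℝ → (EuclideanSpace ℝ (Fin 3)) → (EuclideanSpace ℝ (Fin 3))}
    {p : ℝ → (EuclideanSpace ℝ (Fin 3)) → ℝ} (hsol : IsClassicalNSSolutionOn (Ico 0 T) ν 0 u p)
    {γ : ℝ≥0∞} (hγ0 : γ ≠ 0) (hγtop : γ ≠ ⊤) (j : Fin 3) :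
    AEMeasurable (fun t => eLpNorm (fun x => (EuclideanSpace.proj j :
      EuclideanSpace ℝ (Fin 3) →L[ℝ] ℝ).comp (fderiv ℝ (u t) x)) γ volume)
      (volume.restrict (Ioo 0 T)) := by
  have hD : IsSmoothSpaceTimeOn (Ico 0 T) (fun t x => fderiv ℝ (u t) x) :=
    hsol.smooth_velocity.fderiv_slice (uniqueDiffOn_Ico 0 T)
  have hcD : ContinuousOn (fun z : ℝ × EuclideanSpace ℝ (Fin 3) => fderiv ℝ (u z.1) z.2)
      (Ioo 0 T ×ˢ univ) :=
    hD.continuousOn.mono (prod_mono Ioo_subset_Ico_self Subset.rfl)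
  have hmeasD : AEStronglyMeasurable (fun z : ℝ × EuclideanSpace ℝ (Fin 3) => fderiv ℝ (u z.1) z.2)
      ((volume.restrict (Ioo 0 T)).prod volume) := by
    rw [Measure.restrict_prod_eq_prod_univ]
    exact hcD.aestronglyMeasurable (measurableSet_Ioo.prod MeasurableSet.univ)
  have hcj : Continuous fun L : EuclideanSpace ℝ (Fin 3) →L[ℝ] EuclideanSpace ℝ (Fin 3) =>
      (EuclideanSpace.proj j : EuclideanSpace ℝ (Fin 3) →L[ℝ] ℝ).comp L :=
    continuous_const.clm_comp continuous_id
  have hmj : AEStronglyMeasurable (fun z : ℝ × EuclideanSpace ℝ (Fin 3) =>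
      (EuclideanSpace.proj j : EuclideanSpace ℝ (Fin 3) →L[ℝ] ℝ).comp (fderiv ℝ (u z.1) z.2))
      ((volume.restrict (Ioo 0 T)).prod volume) := hcj.comp_aestronglyMeasurable hmeasD
  have hGI : AEMeasurable (fun t => ∫⁻ x, ‖(EuclideanSpace.proj j :
      EuclideanSpace ℝ (Fin 3) →L[ℝ] ℝ).comp (fderiv ℝ (u t) x)‖ₑ ^ γ.toReal)
      (volume.restrict (Ioo 0 T)) :=
    (hmj.enorm.pow_const _).lintegral_prod_right'
  have heq : (fun t => eLpNorm (fun x => (EuclideanSpace.proj j :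
      EuclideanSpace ℝ (Fin 3) →L[ℝ] ℝ).comp (fderiv ℝ (u t) x)) γ volume) =
      fun t => (∫⁻ x, ‖(EuclideanSpace.proj j : EuclideanSpace ℝ (Fin 3) →L[ℝ] ℝ).comp
        (fderiv ℝ (u t) x)‖ₑ ^ γ.toReal) ^ (1 / γ.toReal) :=
    funext fun t => eLpNorm_eq_lintegral_rpow_enorm_toReal hγ0 hγtop
  rw [heq]
  exact hGI.pow_const _

/-- **Chae–Choe's second criterion with the printed hypothesis `2/α + 3/γ ≤ 1`** (Chae–Choe 1999,
Thm. 2: "`Dṽ ∈ L^{α,γ}_T` with `2/α + 3/γ ≤ 1`"), for `3 < γ < ∞` and any `α ≤ ∞`: on the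
bounded interval `(0, T)` the hypothesis reduces to the critical one `2/α' + 3/γ = 1`,
`α' = 2γ/(γ−3) ≤ α`, by Hölder's inequality in time (`MemLqLp.of_exponent_le` with the time
measurability of the slice norms of a classical solution), and
`chaeChoe_two_velocity_gradients_criterion` applies. [cite: ChaeChoe1999, Thm. 2 (p. 2)] -/
theorem chaeChoe_two_velocity_gradients_criterion_of_le {ν : ℝ} (hν : 0 < ν) {T : ℝ}
    (hT : 0 < T)
    {u : ℝ → (EuclideanSpace ℝ (Fin 3)) → (EuclideanSpace ℝ (Fin 3))}
    {p : ℝ → (EuclideanSpace ℝ (Fin 3)) → ℝ}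
    (hsol : IsClassicalNSSolutionOn (Ico 0 T) ν 0 u p)
    (hreg : ∀ T'' < T, HasBoundedSobolevNormsOn (Icc 0 T'') u)
    {α γ : ℝ≥0∞} (hγ : 3 < γ) (hγtop : γ < ⊤) (hαγ : 2 / α + 3 / γ ≤ 1) (k : Fin 3)
    (hG : ∀ j, j ≠ k → MemLqLp α γ
      (fun t x => (EuclideanSpace.proj j : EuclideanSpace ℝ (Fin 3) →L[ℝ] ℝ).comp (fderiv ℝ (u t) x))
      (Ioo 0 T)) :
    HasSobolevExtensionPast ν u T := by
  -- the real exponent data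
  have hγ0 : γ ≠ 0 := (lt_trans (by norm_num) hγ).ne'
  have hγtop' : γ ≠ ⊤ := hγtop.ne
  set ρ : ℝ := γ.toReal with hρ
  have hρ3 : 3 < ρ := toReal_three_lt hγ hγtop'
  have hρ0 : 0 < ρ := by linarith
  have hρ3' : 0 < ρ - 3 := by linarith
  have hγρ : γ = ENNReal.ofReal ρ := (ENNReal.ofReal_toReal hγtop').symm
  -- the critical time exponent `α' = 2ρ/(ρ-3)`, `2/α' + 3/γ = 1`
  set a' : ℝ := 2 * ρ / (ρ - 3) with ha'
  have ha'0 : 0 < a' := by rw [ha']; positivity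
  set α' : ℝ≥0∞ := ENNReal.ofReal a' with hα'
  have hα'γ : 2 / α' + 3 / γ = 1 := by
    rw [hα', hγρ, show (2 : ℝ≥0∞) = ENNReal.ofReal 2 by norm_num,
      show (3 : ℝ≥0∞) = ENNReal.ofReal 3 by norm_num,
      ← ENNReal.ofReal_div_of_pos ha'0, ← ENNReal.ofReal_div_of_pos hρ0,
      ← ENNReal.ofReal_add (by positivity) (by positivity), ← ENNReal.ofReal_one]
    congr 1
    rw [ha']; field_simp; ring
  -- `α' ≤ α`
  have hα'α : α' ≤ α := by
    by_cases hαtop : α = ⊤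
    · rw [hαtop]; exact le_top
    · have hα0 : α ≠ 0 := by
        rintro rfl
        rw [ENNReal.div_zero (by norm_num : (2 : ℝ≥0∞) ≠ 0), top_add] at hαγ
        exact absurd hαγ (not_le.2 ENNReal.one_lt_top)
      have ha0 : 0 < α.toReal := ENNReal.toReal_pos hα0 hαtop
      have h2 : 2 / α.toReal + 3 / ρ ≤ 1 := by
        have hfin1 : 2 / α ≠ ⊤ := ENNReal.div_ne_top (by norm_num) hα0
        have hfin2 : 3 / γ ≠ ⊤ := ENNReal.div_ne_top (by norm_num) hγ0
        have h := (ENNReal.toReal_le_toReal (ENNReal.add_ne_top.2 ⟨hfin1, hfin2⟩) ENNReal.one_ne_top).2 hαγ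
        rw [ENNReal.toReal_add hfin1 hfin2, ENNReal.toReal_div, ENNReal.toReal_div,
          ENNReal.toReal_ofNat, ENNReal.toReal_ofNat, ENNReal.toReal_one] at h
        exact h
      have h2' : 2 / α.toReal ≤ 1 - 3 / ρ := by linarith
      have h2'' : 2 ≤ (1 - 3 / ρ) * α.toReal := (div_le_iff₀ ha0).1 h2'
      have h3 : a' ≤ α.toReal := by
        rw [ha', div_le_iff₀ hρ3']
        have e : (1 - 3 / ρ) * α.toReal * ρ = α.toReal * (ρ - 3) := by field_simp
        nlinarith [h2'', e, hρ0]
      calc α' = ENNReal.ofReal a' := rfl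
        _ ≤ ENNReal.ofReal α.toReal := ENNReal.ofReal_le_ofReal h3
        _ = α := ENNReal.ofReal_toReal hαtop
  -- Hölder in time
  have hG' : ∀ j, j ≠ k → MemLqLp α' γ
      (fun t x => (EuclideanSpace.proj j : EuclideanSpace ℝ (Fin 3) →L[ℝ] ℝ).comp (fderiv ℝ (u t) x))
      (Ioo 0 T) := by
    intro j hj
    refine (hG j hj).of_exponent_le hα'α measure_Ioo_lt_top.ne ?_
    exact (ENNReal.measurable_toReal.comp_aemeasurable
      (aemeasurable_eLpNorm_proj_fderiv hsol hγ0 hγtop' j)).aestronglyMeasurable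
  exact chaeChoe_two_velocity_gradients_criterion hν hT hsol hreg hγ hγtop hα'γ k hG'

/-! ### The endpoint `γ = 3`, `α = ∞` -/

set_option maxHeartbeats 1600000 in
/-- **The estimate (13) at the endpoint `γ = 3`** (Chae–Choe 1999, proof of Thm. 2, (13) with
`γ = 3`: `|∫(ω·∇)ṽ·ω̃| ≤ ‖ω‖₂‖∇ṽ‖₃‖ω̃‖₆ ≤ C‖ω‖₂‖∇ṽ‖₃‖∇ω̃‖₂ ≤ C‖∇ṽ‖₃²‖ω‖₂² + (ν/2)‖∇ω̃‖₂²`).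
For `ν > 0` and an index `k` there is `C = C(ν) ≥ 0` such that every `C^∞` field `v` on `ℝ³`
with `∇v` bounded, `∇v, ∇²v ∈ L²` and `∇v_{k+1}, ∇v_{k+2} ∈ L³` satisfies
`2∫⟪P_kω, P_k((∇v)ω)⟫ ≤ ν ∫|∇(P_kω)|²_F + C (‖∇v_{k+1}‖₃ + ‖∇v_{k+2}‖₃)² ∫|ω|²`
(Hölder `3, 3/2` and `2, 6`, Sobolev `‖P_kω‖₆ ≤ K‖∇(P_kω)‖₂`, Young); here the coefficient
multiplies the forcing `∫|ω|²`, so in the criterion the time exponent is `α = ∞`.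
[cite: ChaeChoe1999, proof of Thm. 2, (13) (p. 5)] -/
theorem exists_two_mul_integral_proj_stretching_le_three {ν : ℝ} (hν : 0 < ν) (k : Fin 3) :
    ∃ C : ℝ, 0 ≤ C ∧ ∀ v : EuclideanSpace ℝ (Fin 3) → EuclideanSpace ℝ (Fin 3), ContDiff ℝ ∞ v →
      ∀ {B₁ : ℝ}, (∀ x, ‖fderiv ℝ v x‖ ≤ B₁) →
      (∫⁻ x, ‖iteratedFDeriv ℝ 1 v x‖ₑ ^ 2 < ⊤) → (∫⁻ x, ‖iteratedFDeriv ℝ 2 v x‖ₑ ^ 2 < ⊤) →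
      eLpNorm (fun x => (EuclideanSpace.proj (k + 1) : EuclideanSpace ℝ (Fin 3) →L[ℝ] ℝ).comp (fderiv ℝ v x)) 3 volume < ⊤ → eLpNorm (fun x => (EuclideanSpace.proj (k + 2) : EuclideanSpace ℝ (Fin 3) →L[ℝ] ℝ).comp (fderiv ℝ v x)) 3 volume < ⊤ →
        2 * ∫ x, ⟪(ContinuousLinearMap.id ℝ (EuclideanSpace ℝ (Fin 3)) - ContinuousLinearMap.smulRight (EuclideanSpace.proj k : EuclideanSpace ℝ (Fin 3) →L[ℝ] ℝ) (EuclideanSpace.basisFun (Fin 3) ℝ k : EuclideanSpace ℝ (Fin 3))) (curl v x), (ContinuousLinearMap.id ℝ (EuclideanSpace ℝ (Fin 3)) - ContinuousLinearMap.smulRight (EuclideanSpace.proj k : EuclideanSpace ℝ (Fin 3) →L[ℝ] ℝ) (EuclideanSpace.basisFun (Fin 3) ℝ k : EuclideanSpace ℝ (Fin 3))) (fderiv ℝ v x (curl v x))⟫ ≤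
          ν * (∫ x, frobeniusNormSq (fderiv ℝ (fun y => (ContinuousLinearMap.id ℝ (EuclideanSpace ℝ (Fin 3)) - ContinuousLinearMap.smulRight (EuclideanSpace.proj k : EuclideanSpace ℝ (Fin 3) →L[ℝ] ℝ) (EuclideanSpace.basisFun (Fin 3) ℝ k : EuclideanSpace ℝ (Fin 3))) (curl v y)) x)) +
            C * ((eLpNorm (fun x => (EuclideanSpace.proj (k + 1) : EuclideanSpace ℝ (Fin 3) →L[ℝ] ℝ).comp (fderiv ℝ v x)) 3 volume).toReal + (eLpNorm (fun x => (EuclideanSpace.proj (k + 2) : EuclideanSpace ℝ (Fin 3) →L[ℝ] ℝ).comp (fderiv ℝ v x)) 3 volume).toReal) ^ 2 *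
              ∫ x, ‖curl v x‖ ^ 2 := by
  set K : ℝ≥0 := SNormLESNormFDerivOfEqConst (EuclideanSpace ℝ (Fin 3))
    (volume : Measure (EuclideanSpace ℝ (Fin 3))) 2 with hK
  set P : EuclideanSpace ℝ (Fin 3) →L[ℝ] EuclideanSpace ℝ (Fin 3) := (ContinuousLinearMap.id ℝ (EuclideanSpace ℝ (Fin 3)) - ContinuousLinearMap.smulRight (EuclideanSpace.proj k : EuclideanSpace ℝ (Fin 3) →L[ℝ] ℝ) (EuclideanSpace.basisFun (Fin 3) ℝ k : EuclideanSpace ℝ (Fin 3))) with hPdef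
  have hK0 : 0 ≤ (K : ℝ) := K.2
  -- exponents
  have hconj : (3 : ℝ).HolderConjugate (3 / 2) := by rw [Real.holderConjugate_iff]; norm_num
  have hconj₁ : (4 / 3 : ℝ).HolderConjugate 4 := by rw [Real.holderConjugate_iff]; norm_num
  have h30 : (3 : ℝ≥0∞) ≠ 0 := by norm_num
  have h3top : (3 : ℝ≥0∞) ≠ ⊤ := by norm_num
  -- the Young constant: `2A √Z √R ≤ (ν/2) R + c₀ (2A)² Z`
  set c₀ : ℝ := (1 / 2 : ℝ) * (2 * (1 - 1 / 2)) ^ ((1 - 1 / 2) / (1 / 2 : ℝ)) * ν ^ (-((1 - 1 / 2) / (1 / 2 : ℝ)))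
    with hc₀
  have hc₀0 : 0 ≤ c₀ := by
    rw [hc₀]
    have : 0 ≤ ν ^ (-((1 - 1 / 2) / (1 / 2 : ℝ))) := Real.rpow_nonneg hν.le _
    positivity
  set C : ℝ := c₀ * (2 * (K : ℝ)) ^ 2 with hCdef
  have hC0 : 0 ≤ C := by rw [hCdef]; positivity
  refine ⟨C, hC0, ?_⟩
  intro v hv B₁ hB₁ hv1 hv2' hN1 hN2
  -- the vorticity, its two components `w = P ω`, the component gradients, and their regularity
  have hv3 : ContDiff ℝ 3 v := hv.of_le (by norm_cast)
  set om : EuclideanSpace ℝ (Fin 3) → EuclideanSpace ℝ (Fin 3) := curl v with homdef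
  have hom : ContDiff ℝ ∞ om := contDiff_curl (n := ⊤) (hv.of_le (by exact_mod_cast le_top))
  have hom1 : ContDiff ℝ 1 om := hom.of_le (by norm_cast)
  set w : EuclideanSpace ℝ (Fin 3) → EuclideanSpace ℝ (Fin 3) := fun x => P (om x) with hwdef
  have hw : ContDiff ℝ ∞ w := hom.continuousLinearMap_comp P
  have hw1 : ContDiff ℝ 1 w := hw.of_le (by norm_cast)
  have cω : Continuous om := hom.continuous
  have cw : Continuous w := hw.continuous
  have cDv : Continuous (fderiv ℝ v) := hv.continuous_fderiv (by simp)
  set G : Fin 3 → EuclideanSpace ℝ (Fin 3) → (EuclideanSpace ℝ (Fin 3) →L[ℝ] ℝ) := fun j x =>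
    (EuclideanSpace.proj j : EuclideanSpace ℝ (Fin 3) →L[ℝ] ℝ).comp (fderiv ℝ v x) with hGdef
  have cG : ∀ j, Continuous (G j) := fun j => continuous_const.clm_comp cDv
  have hB₁0 : 0 ≤ B₁ := (norm_nonneg _).trans (hB₁ 0)
  have hGle : ∀ j x, ‖G j x‖ ≤ ‖fderiv ℝ v x‖ := by
    intro j x
    refine ContinuousLinearMap.opNorm_le_bound _ (norm_nonneg _) fun y => ?_
    rw [hGdef]
    dsimp only
    rw [ContinuousLinearMap.comp_apply, Real.norm_eq_abs]
    exact (abs_apply_le_norm_vg _ j).trans ((fderiv ℝ v x).le_opNorm y)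
  -- `ω, Pω, ∇(Pω) ∈ L²`
  set κ : ℝ := ‖curlCLM‖ with hκ
  have l2ω : ∫⁻ x, ‖om x‖ₑ ^ 2 < ⊤ :=
    lt_of_le_of_lt (lintegral_curl_sq_le v) (ENNReal.mul_lt_top ENNReal.ofReal_lt_top hv1)
  have l2w : ∫⁻ x, ‖w x‖ₑ ^ 2 < ⊤ := by
    refine lintegral_enorm_sq_lt_top_of_norm_le (fun x => ?_) (lintegral_enorm_sq_const_smul_lt_top (2 : ℝ) l2ω)
    rw [norm_smul, Real.norm_of_nonneg (by norm_num : (0 : ℝ) ≤ 2)]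
    exact norm_dropC_apply_le_two_mul (om x) k
  have hDw : ∀ x, fderiv ℝ w x = P.comp (fderiv ℝ om x) := fun x =>
    (P.hasFDerivAt.comp x ((hom1.differentiable one_ne_zero) x).hasFDerivAt).fderiv
  have l2Dw : ∫⁻ x, ‖fderiv ℝ w x‖ₑ ^ 2 < ⊤ := by
    have hle : ∀ x, ‖fderiv ℝ w x‖ ≤ ‖(‖P‖ * κ) • iteratedFDeriv ℝ 2 v x‖ := fun x => by
      rw [norm_smul, Real.norm_of_nonneg (by positivity), hDw, mul_assoc]
      refine (P.opNorm_comp_le _).trans (mul_le_mul_of_nonneg_left ?_ (norm_nonneg _))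
      have h1 : ‖fderiv ℝ om x‖ = ‖iteratedFDeriv ℝ 1 om x‖ := by
        rw [← norm_iteratedFDeriv_fderiv, norm_iteratedFDeriv_zero]
      rw [h1, homdef]
      exact norm_iteratedFDeriv_curl_le_opNorm_mul hv3 1 (by norm_num) x
    exact lintegral_enorm_sq_lt_top_of_norm_le hle (lintegral_enorm_sq_const_smul_lt_top _ hv2')
  -- the real quantities `Z = ∫|ω|²`, `R = ∫|∇(Pω)|²_F`
  have i_Z : Integrable (fun x => ‖om x‖ ^ 2) volume := integrable_sq_norm_of_lintegral_lt_top cω l2ω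
  set Z : ℝ := ∫ x, ‖om x‖ ^ 2 with hZ
  have hZ0 : 0 ≤ Z := integral_nonneg fun x => sq_nonneg _
  have hRlt : ∫⁻ x, ENNReal.ofReal (frobeniusNormSq (fderiv ℝ w x)) < ⊤ := by
    calc ∫⁻ x, ENNReal.ofReal (frobeniusNormSq (fderiv ℝ w x))
        ≤ ∫⁻ x, 3 * ‖fderiv ℝ w x‖ₑ ^ 2 :=
          lintegral_mono fun x => ofReal_frobeniusNormSq_le_three_mul_enorm_sq _
      _ = 3 * ∫⁻ x, ‖fderiv ℝ w x‖ₑ ^ 2 := lintegral_const_mul' _ _ (by norm_num)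
      _ < ⊤ := ENNReal.mul_lt_top (by norm_num) l2Dw
  have i_R : Integrable (fun x => frobeniusNormSq (fderiv ℝ w x)) volume :=
    integrable_of_continuous_of_nonneg (continuous_frobeniusNormSq_fderiv hw1 (by simp))
      (fun x => frobeniusNormSq_nonneg _) hRlt
  set R : ℝ := ∫ x, frobeniusNormSq (fderiv ℝ w x) with hR
  have hR0 : 0 ≤ R := integral_nonneg fun x => frobeniusNormSq_nonneg _
  have hRE : ENNReal.ofReal R = ∫⁻ x, ENNReal.ofReal (frobeniusNormSq (fderiv ℝ w x)) :=
    ofReal_integral_eq_lintegral_ofReal i_R (Eventually.of_forall fun x => frobeniusNormSq_nonneg _)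
  have hD : eLpNorm (fderiv ℝ w) 2 volume ^ 2 ≤ ENNReal.ofReal R := by
    rw [← lintegral_enorm_sq_eq_eLpNorm_two_sq, hRE]
    refine lintegral_mono fun x => ?_
    rw [← ofReal_norm, ← ENNReal.ofReal_pow (norm_nonneg _)]
    exact ENNReal.ofReal_le_ofReal (sq_opNorm_le_frobeniusNormSq _)
  have hD' : eLpNorm (fderiv ℝ w) 2 volume ≤ ENNReal.ofReal R ^ (2 : ℝ)⁻¹ := by
    rw [ENNReal.le_rpow_inv_iff two_pos, ENNReal.rpow_two]; exact hD
  have hZE : ENNReal.ofReal Z = ∫⁻ x, ‖om x‖ₑ ^ (2 : ℝ) := by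
    rw [hZ, ofReal_integral_eq_lintegral_ofReal i_Z (Eventually.of_forall fun x => sq_nonneg _)]
    refine lintegral_congr fun x => ?_
    rw [← ofReal_norm, ENNReal.ofReal_rpow_of_nonneg (norm_nonneg _) (by norm_num), Real.rpow_two]
  -- the two controlled component gradients
  set N₁ : ℝ≥0 := (eLpNorm (G (k + 1)) 3 volume).toNNReal with hN₁
  set N₂ : ℝ≥0 := (eLpNorm (G (k + 2)) 3 volume).toNNReal with hN₂
  have hN₁E : ((N₁ : ℝ≥0) : ℝ≥0∞) = eLpNorm (G (k + 1)) 3 volume := ENNReal.coe_toNNReal hN1.ne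
  have hN₂E : ((N₂ : ℝ≥0) : ℝ≥0∞) = eLpNorm (G (k + 2)) 3 volume := ENNReal.coe_toNNReal hN2.ne
  have hN₁R : (eLpNorm (G (k + 1)) 3 volume).toReal = (N₁ : ℝ) := rfl
  have hN₂R : (eLpNorm (G (k + 2)) 3 volume).toReal = (N₂ : ℝ) := rfl
  -- the pointwise structure bound and the majorant `g`
  set g : EuclideanSpace ℝ (Fin 3) → ℝ := fun x =>
    ‖w x‖ * ((‖G (k + 1) x‖ + ‖G (k + 2) x‖) * ‖om x‖) with hg
  have hg0 : ∀ x, 0 ≤ g x := fun x => by positivity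
  have hSg : ∀ x, ⟪w x, P (fderiv ℝ v x (om x))⟫ ≤ g x := fun x =>
    inner_dropC_apply_le (om x) (fderiv ℝ v x) k
  have hgm : AEStronglyMeasurable g volume :=
    (cw.norm.mul ((((cG _).norm).add ((cG _).norm)).mul cω.norm)).aestronglyMeasurable
  have i_g : Integrable g volume := by
    have hdom : Integrable (fun x => 4 * B₁ * ‖om x‖ ^ 2) volume := i_Z.const_mul _
    refine hdom.mono' hgm (Eventually.of_forall fun x => ?_)
    rw [Real.norm_of_nonneg (hg0 x), hg]
    dsimp only
    have h1 : ‖G (k + 1) x‖ ≤ B₁ := (hGle _ x).trans (hB₁ x)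
    have h2 : ‖G (k + 2) x‖ ≤ B₁ := (hGle _ x).trans (hB₁ x)
    have h3 : ‖w x‖ ≤ 2 * ‖om x‖ := norm_dropC_apply_le_two_mul (om x) k
    have hw0 : 0 ≤ ‖om x‖ := norm_nonneg _
    calc ‖w x‖ * ((‖G (k + 1) x‖ + ‖G (k + 2) x‖) * ‖om x‖)
        ≤ (2 * ‖om x‖) * ((B₁ + B₁) * ‖om x‖) := by gcongr
      _ = 4 * B₁ * ‖om x‖ ^ 2 := by ring
  have hSle : ∫ x, ⟪w x, P (fderiv ℝ v x (om x))⟫ ≤ ∫ x, g x := by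
    by_cases hS : Integrable (fun x => ⟪w x, P (fderiv ℝ v x (om x))⟫) volume
    · exact integral_mono hS i_g hSg
    · rw [integral_undef hS]; exact integral_nonneg hg0
  -- `ℝ≥0∞` form of `∫ g`
  have hpt : ∀ x, ENNReal.ofReal (g x) =
      ‖G (k + 1) x‖ₑ * (‖om x‖ₑ * ‖w x‖ₑ) + ‖G (k + 2) x‖ₑ * (‖om x‖ₑ * ‖w x‖ₑ) := by
    intro x
    rw [hg]
    dsimp only
    rw [ENNReal.ofReal_mul (norm_nonneg _), ENNReal.ofReal_mul (by positivity),
      ENNReal.ofReal_add (norm_nonneg _) (norm_nonneg _)]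
    simp only [ofReal_norm]
    ring
  have mω : AEMeasurable (fun x => ‖om x‖ₑ) volume := cω.aemeasurable.enorm
  have mw : AEMeasurable (fun x => ‖w x‖ₑ) volume := cw.aemeasurable.enorm
  have mG : ∀ j, AEMeasurable (fun x => ‖G j x‖ₑ) volume := fun j => (cG j).aemeasurable.enorm
  -- Hölder (`2`, `6`) inside the `L^{3/2}` norm: `‖ |ω| |Pω| ‖_{3/2} ≤ ‖ω‖₂ ‖Pω‖₆`
  have hW6 : (∫⁻ x, ‖w x‖ₑ ^ (6 : ℝ)) ^ (1 / (6 : ℝ)) = eLpNorm w 6 volume := by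
    rw [eLpNorm_eq_lintegral_rpow_enorm_toReal (by norm_num) (by norm_num), ENNReal.toReal_ofNat]
  have hCS : (∫⁻ x, (‖om x‖ₑ * ‖w x‖ₑ) ^ (3 / 2 : ℝ)) ^ (1 / (3 / 2 : ℝ)) ≤
      (∫⁻ x, ‖om x‖ₑ ^ (2 : ℝ)) ^ (1 / 2 : ℝ) * eLpNorm w 6 volume := by
    have hmul : ∀ x, (‖om x‖ₑ * ‖w x‖ₑ) ^ (3 / 2 : ℝ) = ‖om x‖ₑ ^ (3 / 2 : ℝ) * ‖w x‖ₑ ^ (3 / 2 : ℝ) :=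
      fun x => ENNReal.mul_rpow_of_nonneg _ _ (by norm_num)
    have hpowf : ∀ y : ℝ≥0∞, (y ^ (3 / 2 : ℝ)) ^ (4 / 3 : ℝ) = y ^ (2 : ℝ) := fun y => by
      rw [← ENNReal.rpow_mul]; norm_num
    have hpowg : ∀ y : ℝ≥0∞, (y ^ (3 / 2 : ℝ)) ^ (4 : ℝ) = y ^ (6 : ℝ) := fun y => by
      rw [← ENNReal.rpow_mul]; norm_num
    have hcs := ENNReal.lintegral_mul_le_Lp_mul_Lq volume hconj₁
      (f := fun x => ‖om x‖ₑ ^ (3 / 2 : ℝ)) (g := fun x => ‖w x‖ₑ ^ (3 / 2 : ℝ))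
      (mω.pow_const _) (mw.pow_const _)
    simp only [Pi.mul_apply, hpowf, hpowg] at hcs
    calc (∫⁻ x, (‖om x‖ₑ * ‖w x‖ₑ) ^ (3 / 2 : ℝ)) ^ (1 / (3 / 2 : ℝ))
        = (∫⁻ x, ‖om x‖ₑ ^ (3 / 2 : ℝ) * ‖w x‖ₑ ^ (3 / 2 : ℝ)) ^ (1 / (3 / 2 : ℝ)) := by
          rw [lintegral_congr fun x => hmul x]
      _ ≤ ((∫⁻ x, ‖om x‖ₑ ^ (2 : ℝ)) ^ (1 / (4 / 3 : ℝ)) * (∫⁻ x, ‖w x‖ₑ ^ (6 : ℝ)) ^ (1 / (4 : ℝ))) ^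
            (1 / (3 / 2 : ℝ)) := by
          gcongr
      _ = (∫⁻ x, ‖om x‖ₑ ^ (2 : ℝ)) ^ (1 / 2 : ℝ) * eLpNorm w 6 volume := by
          rw [ENNReal.mul_rpow_of_nonneg _ _ (by positivity), ← ENNReal.rpow_mul, ← ENNReal.rpow_mul,
            ← hW6]
          congr 2 <;> norm_num
  -- Hölder (`3`, `3/2`) for each component gradient
  have hT : ∀ j, ∫⁻ x, ‖G j x‖ₑ * (‖om x‖ₑ * ‖w x‖ₑ) ≤
      eLpNorm (G j) 3 volume * ((∫⁻ x, ‖om x‖ₑ ^ (2 : ℝ)) ^ (1 / 2 : ℝ) * eLpNorm w 6 volume) := by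
    intro j
    have h := ENNReal.lintegral_mul_le_Lp_mul_Lq volume hconj (f := fun x => ‖G j x‖ₑ)
      (g := fun x => ‖om x‖ₑ * ‖w x‖ₑ) (mG j) (mω.mul mw)
    simp only [Pi.mul_apply] at h
    have hf : (∫⁻ x, ‖G j x‖ₑ ^ (3 : ℝ)) ^ (1 / (3 : ℝ)) = eLpNorm (G j) 3 volume := by
      rw [eLpNorm_eq_lintegral_rpow_enorm_toReal h30 h3top, ENNReal.toReal_ofNat]
    rw [hf] at h
    exact h.trans (mul_le_mul' le_rfl hCS)
  -- the bound for `∫ g` in `ℝ≥0∞`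
  have hsum : ENNReal.ofReal (∫ x, g x) ≤
      ((N₁ : ℝ≥0∞) + N₂) * ((∫⁻ x, ‖om x‖ₑ ^ (2 : ℝ)) ^ (1 / 2 : ℝ) * eLpNorm w 6 volume) := by
    rw [ofReal_integral_eq_lintegral_ofReal i_g (Eventually.of_forall hg0)]
    have m1 : AEMeasurable (fun x => ‖G (k + 1) x‖ₑ * (‖om x‖ₑ * ‖w x‖ₑ)) volume :=
      (mG _).mul (mω.mul mw)
    calc ∫⁻ x, ENNReal.ofReal (g x)
        = ∫⁻ x, (‖G (k + 1) x‖ₑ * (‖om x‖ₑ * ‖w x‖ₑ) + ‖G (k + 2) x‖ₑ * (‖om x‖ₑ * ‖w x‖ₑ)) :=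
          lintegral_congr hpt
      _ = (∫⁻ x, ‖G (k + 1) x‖ₑ * (‖om x‖ₑ * ‖w x‖ₑ)) +
            ∫⁻ x, ‖G (k + 2) x‖ₑ * (‖om x‖ₑ * ‖w x‖ₑ) := lintegral_add_left' m1 _
      _ ≤ (N₁ : ℝ≥0∞) * ((∫⁻ x, ‖om x‖ₑ ^ (2 : ℝ)) ^ (1 / 2 : ℝ) * eLpNorm w 6 volume) +
            (N₂ : ℝ≥0∞) * ((∫⁻ x, ‖om x‖ₑ ^ (2 : ℝ)) ^ (1 / 2 : ℝ) * eLpNorm w 6 volume) := by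
          have h1' := hT (k + 1)
          have h2' := hT (k + 2)
          rw [← hN₁E] at h1'
          rw [← hN₂E] at h2'
          exact add_le_add h1' h2'
      _ = ((N₁ : ℝ≥0∞) + N₂) * ((∫⁻ x, ‖om x‖ₑ ^ (2 : ℝ)) ^ (1 / 2 : ℝ) * eLpNorm w 6 volume) := by ring
  -- Sobolev: `‖Pω‖₆ ≤ K ‖∇(Pω)‖₂ ≤ K R^{1/2}`
  have hS : eLpNorm w 6 volume ≤ K * eLpNorm (fderiv ℝ w) 2 volume :=
    eLpNorm_six_le_eLpNorm_fderiv_two volume finrank_euclideanSpace_fin hw1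
      (eLpNorm_two_lt_top_of_lintegral_enorm_sq_lt_top l2w)
  have hS' : eLpNorm w 6 volume ≤ K * ENNReal.ofReal R ^ (2 : ℝ)⁻¹ :=
    hS.trans (mul_le_mul' le_rfl hD')
  -- back to the reals
  have hfin : ((N₁ : ℝ≥0∞) + N₂) * ((∫⁻ x, ‖om x‖ₑ ^ (2 : ℝ)) ^ (1 / 2 : ℝ) *
      ((K : ℝ≥0∞) * ENNReal.ofReal R ^ (2 : ℝ)⁻¹)) ≠ ⊤ := by
    rw [← hZE]
    refine ENNReal.mul_ne_top (by simp) (ENNReal.mul_ne_top ?_ ?_)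
    · exact ENNReal.rpow_ne_top_of_nonneg (by norm_num) ENNReal.ofReal_ne_top
    · exact ENNReal.mul_ne_top ENNReal.coe_ne_top
        (ENNReal.rpow_ne_top_of_nonneg (by norm_num) ENNReal.ofReal_ne_top)
  have hgR : ∫ x, g x ≤ ((N₁ : ℝ) + N₂) * (Z ^ (1 / 2 : ℝ) * ((K : ℝ) * R ^ (2 : ℝ)⁻¹)) := by
    have h1 : ENNReal.ofReal (∫ x, g x) ≤ ((N₁ : ℝ≥0∞) + N₂) * ((∫⁻ x, ‖om x‖ₑ ^ (2 : ℝ)) ^ (1 / 2 : ℝ) *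
        ((K : ℝ≥0∞) * ENNReal.ofReal R ^ (2 : ℝ)⁻¹)) :=
      hsum.trans (mul_le_mul' le_rfl (mul_le_mul' le_rfl hS'))
    have h2 := (ENNReal.ofReal_le_iff_le_toReal hfin).1 h1
    refine h2.trans_eq ?_
    rw [← hZE, ENNReal.toReal_mul, ENNReal.toReal_mul, ← ENNReal.toReal_rpow, ENNReal.toReal_mul,
      ← ENNReal.toReal_rpow, ENNReal.toReal_ofReal hZ0, ENNReal.toReal_ofReal hR0,
      ENNReal.toReal_add ENNReal.coe_ne_top ENNReal.coe_ne_top,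
      ENNReal.coe_toReal, ENNReal.coe_toReal, ENNReal.coe_toReal]
  -- Young: `2 N K Z^{1/2} R^{1/2} ≤ (ν/2) R + c₀ (2NK)² Z`
  set Nr : ℝ := (N₁ : ℝ) + N₂ with hNr
  have hNr0 : 0 ≤ Nr := by positivity
  set A₀ : ℝ := 2 * (K : ℝ) * Nr with hA₀
  have hA₀0 : 0 ≤ A₀ := by positivity
  have h2g : 2 * ∫ x, g x ≤ A₀ * Z ^ (1 / 2 : ℝ) * R ^ (1 - 1 / 2 : ℝ) := by
    have e : (1 - 1 / 2 : ℝ) = (2 : ℝ)⁻¹ := by norm_num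
    rw [e]
    calc 2 * ∫ x, g x ≤ 2 * (Nr * (Z ^ (1 / 2 : ℝ) * ((K : ℝ) * R ^ (2 : ℝ)⁻¹))) := by linarith [hgR]
      _ = A₀ * Z ^ (1 / 2 : ℝ) * R ^ (2 : ℝ)⁻¹ := by rw [hA₀]; ring
  have hyoung : 2 * ∫ x, g x ≤ ν / 2 * R + c₀ * A₀ ^ (1 / (1 / 2 : ℝ)) * Z := by
    have h := mul_rpow_mul_rpow_le_absorb (θ := 1 / 2) (by norm_num) (by norm_num) hν hA₀0 hR0 hZ0
    rw [hc₀]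
    exact h2g.trans h
  have hA₀sq : A₀ ^ (1 / (1 / 2 : ℝ)) = (2 * (K : ℝ)) ^ 2 * Nr ^ 2 := by
    rw [show (1 / (1 / 2 : ℝ)) = ((2 : ℕ) : ℝ) by norm_num, Real.rpow_natCast, hA₀]; ring
  -- conclusion
  have hmain : 2 * ∫ x, g x ≤ ν * R + C * Nr ^ 2 * Z := by
    rw [hA₀sq] at hyoung
    have hνR : ν / 2 * R ≤ ν * R := by nlinarith
    rw [hCdef]
    nlinarith [hyoung, hνR]
  calc 2 * ∫ x, ⟪w x, P (fderiv ℝ v x (om x))⟫ ≤ 2 * ∫ x, g x := by linarith [hSle]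
    _ ≤ ν * R + C * Nr ^ 2 * Z := hmain
    _ = ν * R + C * ((eLpNorm (G (k + 1)) 3 volume).toReal + (eLpNorm (G (k + 2)) 3 volume).toReal) ^ 2 * Z := by
        rw [hN₁R, hN₂R]

set_option maxHeartbeats 1600000 in
/-- **Chae–Choe's second criterion at the endpoint `γ = 3`, `α = ∞`** (Chae–Choe 1999, Thm. 2
with `Dṽ ∈ L^∞(0,T; L³)`, `2/∞ + 3/3 = 1`). For a classical unforced solution on `ℝ³ × [0, T)`
in the Beale–Kato–Majda class: if for an index `k` the gradients of the two other velocity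
components lie in `L^∞(0,T; L³(ℝ³))`, then the solution continues in the class past `T`. Proof:
`exists_two_mul_integral_proj_stretching_le_three` at a.e. time with the coefficient bounded by
its essential supremum in time, the slab bound `integral_sq_norm_clm_curl_le_of_weight_slab_ae`
with the zero weight and the enstrophy forcing (Tao's dissipation budget), `|ω_j| ≤ |P_kω|`, and
`hasSobolevExtensionPast_of_two_vorticity_components_bounded`.
[cite: ChaeChoe1999, Thm. 2 (p. 2) and proof, (13) (pp. 5–6); Tao2011, Lemma 8.1] -/
theorem chaeChoe_two_velocity_gradients_criterion_three {ν : ℝ} (hν : 0 < ν) {T : ℝ} (hT : 0 < T)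
    {u : ℝ → (EuclideanSpace ℝ (Fin 3)) → (EuclideanSpace ℝ (Fin 3))}
    {p : ℝ → (EuclideanSpace ℝ (Fin 3)) → ℝ}
    (hsol : IsClassicalNSSolutionOn (Ico 0 T) ν 0 u p)
    (hreg : ∀ T'' < T, HasBoundedSobolevNormsOn (Icc 0 T'') u) (k : Fin 3)
    (hG : ∀ j, j ≠ k → MemLqLp ⊤ 3
      (fun t x => (EuclideanSpace.proj j : EuclideanSpace ℝ (Fin 3) →L[ℝ] ℝ).comp (fderiv ℝ (u t) x))
      (Ioo 0 T)) :
    HasSobolevExtensionPast ν u T := by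
  obtain ⟨Ce, hCetop, hTao⟩ := tao_finite_energy_smooth_energy_bound_holds
  obtain ⟨C, hC0, hstrC⟩ := exists_two_mul_integral_proj_stretching_le_three hν k
  -- the component gradients and their `L^∞_t L³_x` bounds
  set Gr : Fin 3 → ℝ → EuclideanSpace ℝ (Fin 3) → (EuclideanSpace ℝ (Fin 3) →L[ℝ] ℝ) :=
    fun j t x => (EuclideanSpace.proj j : EuclideanSpace ℝ (Fin 3) →L[ℝ] ℝ).comp (fderiv ℝ (u t) x)
    with hGr
  set N : Fin 3 → ℝ → ℝ := fun j t => (eLpNorm (Gr j t) 3 volume).toReal with hN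
  have hN0 : ∀ j t, 0 ≤ N j t := fun j t => ENNReal.toReal_nonneg
  have hbound : ∀ j, j ≠ k → ∃ S : ℝ, 0 ≤ S ∧ ∀ᵐ t ∂volume, t ∈ Ioo 0 T →
      eLpNorm (Gr j t) 3 volume < ⊤ ∧ N j t ≤ S := by
    intro j hj
    have h := hG j hj
    set Se : ℝ≥0∞ := eLqLpNorm ⊤ 3 (Gr j) (Ioo 0 T) with hSe
    have hSetop : Se < ⊤ := h.2
    refine ⟨Se.toReal, ENNReal.toReal_nonneg, ?_⟩
    have h1 : ∀ᵐ t ∂volume, t ∈ Ioo 0 T → MemLp (Gr j t) 3 volume :=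
      (ae_restrict_iff' measurableSet_Ioo).1 h.1
    have h2 : ∀ᵐ t ∂volume, t ∈ Ioo 0 T → ‖N j t‖ₑ ≤ Se := by
      have h' : ∀ᵐ t ∂(volume.restrict (Ioo 0 T)), ‖N j t‖ₑ ≤ Se := by
        rw [hSe, eLqLpNorm_def, eLpNorm_exponent_top]
        exact ae_le_eLpNormEssSup
      exact (ae_restrict_iff' measurableSet_Ioo).1 h'
    filter_upwards [h1, h2] with t ht1 ht2 htI
    refine ⟨(ht1 htI).eLpNorm_lt_top, ?_⟩
    have h3 := ht2 htI
    rw [Real.enorm_eq_ofReal (hN0 j t)] at h3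
    exact (ENNReal.ofReal_le_iff_le_toReal hSetop.ne).1 h3
  obtain ⟨S₁, hS₁0, hae1⟩ := hbound (k + 1) (fin3_add_one_ne_vg k)
  obtain ⟨S₂, hS₂0, hae2⟩ := hbound (k + 2) (fin3_add_two_ne_vg k)
  set β : ℝ := C * (S₁ + S₂) ^ 2 with hβ
  have hβ0 : 0 ≤ β := by positivity
  -- the initial energy and the dissipation budget
  have hreg0 : HasBoundedSobolevNormsOn (Icc 0 (T / 2)) u := hreg (T / 2) (by linarith)
  have h00 : (0 : ℝ) ∈ Icc 0 (T / 2) := ⟨le_rfl, by linarith⟩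
  set E₀ : ℝ≥0∞ := ∫⁻ x, ‖u 0 x‖ₑ ^ 2 with hE₀
  have hE₀top : E₀ < ⊤ := by
    obtain ⟨C0, hC0'⟩ := hreg0 0
    refine lt_of_le_of_lt (le_of_eq (lintegral_congr fun x => ?_)) ((hC0' 0 h00).trans_lt ENNReal.coe_lt_top)
    rw [← ofReal_norm, ← ofReal_norm, norm_iteratedFDeriv_zero]
  set κ : ℝ := ‖curlCLM‖ with hκ
  have hν0 : ENNReal.ofReal ν ≠ 0 := (ENNReal.ofReal_pos.2 hν).ne'
  set E₁E : ℝ≥0∞ := ENNReal.ofReal (κ ^ 2) * (Ce * E₀ / ENNReal.ofReal ν) with hE₁E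
  have hE₁Etop : E₁E < ⊤ := ENNReal.mul_lt_top ENNReal.ofReal_lt_top
    (ENNReal.div_lt_top (ENNReal.mul_ne_top hCetop.ne hE₀top.ne) hν0)
  set E₁ : ℝ := E₁E.toReal with hE₁
  have hE₁0 : 0 ≤ E₁ := ENNReal.toReal_nonneg
  have hE₁of : ENNReal.ofReal E₁ = E₁E := ENNReal.ofReal_toReal hE₁Etop.ne
  set Y₀ : ℝ := ∫ x, ‖(ContinuousLinearMap.id ℝ (EuclideanSpace ℝ (Fin 3)) - ContinuousLinearMap.smulRight (EuclideanSpace.proj k : EuclideanSpace ℝ (Fin 3) →L[ℝ] ℝ) (EuclideanSpace.basisFun (Fin 3) ℝ k : EuclideanSpace ℝ (Fin 3))) (curl (u 0) x)‖ ^ 2 with hY₀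
  have hY₀0 : 0 ≤ Y₀ := integral_nonneg fun x => sq_nonneg _
  set M : ℝ := (Y₀ + β * E₁) * Real.exp 0 with hM
  -- the uniform bound on `∫|ω_j|²`, then Thm. 1
  refine hasSobolevExtensionPast_of_two_vorticity_components_bounded hν hT hsol hreg k (M := M) ?_
  intro j hj t ht'
  have ht : t ∈ Ico 0 T := Ioo_subset_Ico_self ht'
  -- a closed slab containing `t`
  set T'' : ℝ := (t + T) / 2 with hT''def
  have htT'' : t < T'' := by rw [hT''def]; linarith [ht.2]
  have hT''T : T'' < T := by rw [hT''def]; linarith [ht.2]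
  have hT''pos : 0 < T'' := lt_of_le_of_lt ht.1 htT''
  have hS : IsClassicalNSSolutionOn (Icc 0 T'') ν 0 u p :=
    hsol.mono (Icc_subset_Ico_right hT''T) (uniqueDiffOn_Icc hT''pos)
  have hB : HasBoundedSobolevNormsOn (Icc 0 T'') u := hreg T'' hT''T
  have htS : t ∈ Icc 0 T'' := ⟨ht.1, htT''.le⟩
  have hsm : ∀ s ∈ Icc 0 T'', ContDiff ℝ ∞ (u s) := fun s hs => hS.contDiff_velocity hs
  have hsm3 : ∀ s ∈ Icc 0 T'', ContDiff ℝ 3 (u s) := fun s hs => (hsm s hs).of_le (by norm_cast)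
  have hfin : ∀ n, ∀ s ∈ Icc 0 T'', ∫⁻ x, ‖iteratedFDeriv ℝ n (u s) x‖ₑ ^ 2 < ⊤ := fun n s hs => by
    obtain ⟨Cn, hCn⟩ := hB n
    exact (hCn s hs).trans_lt ENNReal.coe_lt_top
  obtain ⟨B₁, hB₁0, hB₁⟩ := exists_forall_norm_fderiv_le_of_hasBoundedSobolevNormsOn hsm3 hB
  -- Tao's energy class on the slab: the dissipation budget
  have hfe : ∃ A : ℝ≥0∞, A < ⊤ ∧ ∀ s ∈ Icc 0 T'', ∫⁻ x, ‖u s x‖ₑ ^ 2 ≤ A := by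
    obtain ⟨C0, hC0'⟩ := hB 0
    refine ⟨C0, ENNReal.coe_lt_top, fun s hs => ?_⟩
    refine le_trans (le_of_eq (lintegral_congr fun x => ?_)) (hC0' s hs)
    rw [← ofReal_norm, ← ofReal_norm, norm_iteratedFDeriv_zero]
  obtain ⟨-, hdis⟩ := hTao ν T'' hν hT''pos u p hS hfe
  have hdis' : ∫⁻ s in Ioo 0 T'', ∫⁻ x, ENNReal.ofReal (frobeniusNormSq (fderiv ℝ (u s) x)) ≤
      Ce * E₀ / ENNReal.ofReal ν := by
    rw [ENNReal.le_div_iff_mul_le (Or.inl hν0) (Or.inl ENNReal.ofReal_ne_top), mul_comm]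
    exact hdis
  have hE₁slab : ∫⁻ s in Ioo 0 T'', ENNReal.ofReal (∫ x, ‖curl (u s) x‖ ^ 2) ≤ ENNReal.ofReal E₁ := by
    rw [hE₁of, hE₁E]
    have hpt : ∀ s ∈ Ioo 0 T'', ENNReal.ofReal (∫ x, ‖curl (u s) x‖ ^ 2) ≤
        ENNReal.ofReal (κ ^ 2) * ∫⁻ x, ENNReal.ofReal (frobeniusNormSq (fderiv ℝ (u s) x)) := by
      intro s hs
      have hsS : s ∈ Icc 0 T'' := ⟨hs.1.le, hs.2.le⟩
      have hωc : Continuous (curl (u s)) := continuous_curl ((hsm s hsS).of_le (by norm_cast))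
      have hi : Integrable fun x => ‖curl (u s) x‖ ^ 2 := by
        refine integrable_sq_norm_of_lintegral_lt_top hωc ?_
        exact lt_of_le_of_lt (lintegral_curl_sq_le (u s))
          (ENNReal.mul_lt_top ENNReal.ofReal_lt_top (hfin 1 s hsS))
      rw [ofReal_integral_eq_lintegral_ofReal hi (Eventually.of_forall fun x => sq_nonneg _)]
      have h1 : ∫⁻ x, ENNReal.ofReal (‖curl (u s) x‖ ^ 2) = ∫⁻ x, ‖curl (u s) x‖ₑ ^ 2 :=
        lintegral_congr fun x => by rw [← ofReal_norm, ENNReal.ofReal_pow (norm_nonneg _)]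
      rw [h1]
      refine (lintegral_curl_sq_le (u s)).trans (mul_le_mul' le_rfl (lintegral_mono fun x => ?_))
      rw [← ofReal_norm, norm_iteratedFDeriv_one (u s), ← ENNReal.ofReal_pow (norm_nonneg _)]
      exact ENNReal.ofReal_le_ofReal (sq_opNorm_le_frobeniusNormSq _)
    calc ∫⁻ s in Ioo 0 T'', ENNReal.ofReal (∫ x, ‖curl (u s) x‖ ^ 2)
        ≤ ∫⁻ s in Ioo 0 T'', ENNReal.ofReal (κ ^ 2) *
            ∫⁻ x, ENNReal.ofReal (frobeniusNormSq (fderiv ℝ (u s) x)) := setLIntegral_mono' measurableSet_Ioo hpt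
      _ = ENNReal.ofReal (κ ^ 2) *
            ∫⁻ s in Ioo 0 T'', ∫⁻ x, ENNReal.ofReal (frobeniusNormSq (fderiv ℝ (u s) x)) :=
          lintegral_const_mul' _ _ ENNReal.ofReal_ne_top
      _ ≤ ENNReal.ofReal (κ ^ 2) * (Ce * E₀ / ENNReal.ofReal ν) := mul_le_mul' le_rfl hdis'
  -- the stretching estimate at a.e. time of the slab, with the zero weight
  have hstrS : ∀ᵐ s ∂(volume.restrict (Ioo 0 T'')),
      2 * ∫ x, ⟪(ContinuousLinearMap.id ℝ (EuclideanSpace ℝ (Fin 3)) - ContinuousLinearMap.smulRight (EuclideanSpace.proj k : EuclideanSpace ℝ (Fin 3) →L[ℝ] ℝ) (EuclideanSpace.basisFun (Fin 3) ℝ k : EuclideanSpace ℝ (Fin 3))) (curl (u s) x), (ContinuousLinearMap.id ℝ (EuclideanSpace ℝ (Fin 3)) - ContinuousLinearMap.smulRight (EuclideanSpace.proj k : EuclideanSpace ℝ (Fin 3) →L[ℝ] ℝ) (EuclideanSpace.basisFun (Fin 3) ℝ k : EuclideanSpace ℝ (Fin 3))) (fderiv ℝ (u s) x (curl (u s) x))⟫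 ≤
        ν * (∫ x, frobeniusNormSq (fderiv ℝ (fun y => (ContinuousLinearMap.id ℝ (EuclideanSpace ℝ (Fin 3)) - ContinuousLinearMap.smulRight (EuclideanSpace.proj k : EuclideanSpace ℝ (Fin 3) →L[ℝ] ℝ) (EuclideanSpace.basisFun (Fin 3) ℝ k : EuclideanSpace ℝ (Fin 3))) (curl (u s) y)) x)) +
          β * (∫ x, ‖curl (u s) x‖ ^ 2) +
          (fun _ : ℝ => (0 : ℝ)) s * (∫ x, ‖(ContinuousLinearMap.id ℝ (EuclideanSpace ℝ (Fin 3)) - ContinuousLinearMap.smulRight (EuclideanSpace.proj k : EuclideanSpace ℝ (Fin 3) →L[ℝ] ℝ) (EuclideanSpace.basisFun (Fin 3) ℝ k : EuclideanSpace ℝ (Fin 3))) (curl (u s) x)‖ ^ 2) := by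
    rw [ae_restrict_iff' measurableSet_Ioo]
    filter_upwards [hae1, hae2] with s h1 h2 hsI
    have hsT : s ∈ Ioo 0 T := ⟨hsI.1, hsI.2.trans hT''T⟩
    have hsS : s ∈ Icc 0 T'' := ⟨hsI.1.le, hsI.2.le⟩
    obtain ⟨h1f, h1b⟩ := h1 hsT
    obtain ⟨h2f, h2b⟩ := h2 hsT
    have h := hstrC (u s) (hsm s hsS) (hB₁ s hsS) (hfin 1 s hsS) (hfin 2 s hsS) h1f h2f
    have hZs : 0 ≤ ∫ x, ‖curl (u s) x‖ ^ 2 := integral_nonneg fun x => sq_nonneg _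
    have hcoef : C * (N (k + 1) s + N (k + 2) s) ^ 2 ≤ β := by
      rw [hβ]
      have hs0 : 0 ≤ N (k + 1) s + N (k + 2) s := add_nonneg (hN0 _ s) (hN0 _ s)
      have hle : N (k + 1) s + N (k + 2) s ≤ S₁ + S₂ := add_le_add h1b h2b
      exact mul_le_mul_of_nonneg_left (pow_le_pow_left₀ hs0 hle 2) hC0
    have hNdef : (eLpNorm (Gr (k + 1) s) 3 volume).toReal + (eLpNorm (Gr (k + 2) s) 3 volume).toReal =
        N (k + 1) s + N (k + 2) s := rfl
    rw [zero_mul, add_zero]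
    refine h.trans ?_
    rw [hNdef]
    nlinarith [hcoef, hZs]
  -- the slab bound for `∫|P_k ω|²` (zero weight)
  have hAint : ∫⁻ s in Ioo 0 T'', ENNReal.ofReal ((fun _ : ℝ => (0 : ℝ)) s) ≤ ENNReal.ofReal 0 := by
    simp
  have hY := integral_sq_norm_clm_curl_le_of_weight_slab_ae hν hT''pos hS hB (ContinuousLinearMap.id ℝ (EuclideanSpace ℝ (Fin 3)) - ContinuousLinearMap.smulRight (EuclideanSpace.proj k : EuclideanSpace ℝ (Fin 3) →L[ℝ] ℝ) (EuclideanSpace.basisFun (Fin 3) ℝ k : EuclideanSpace ℝ (Fin 3)))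
    (a := fun _ : ℝ => (0 : ℝ)) (fun _ => le_rfl) (A := 0) le_rfl hAint hβ0 hE₁0 hE₁slab hstrS t htS
  -- `∫|ω_j|² ≤ ∫|P_k ω|²`
  have hvt : ContDiff ℝ ∞ (u t) := hS.contDiff_velocity htS
  have hωc : Continuous (curl (u t)) := continuous_curl (hvt.of_le (by norm_cast))
  have hPc : Continuous fun x => (ContinuousLinearMap.id ℝ (EuclideanSpace ℝ (Fin 3)) - ContinuousLinearMap.smulRight (EuclideanSpace.proj k : EuclideanSpace ℝ (Fin 3) →L[ℝ] ℝ) (EuclideanSpace.basisFun (Fin 3) ℝ k : EuclideanSpace ℝ (Fin 3))) (curl (u t) x) :=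
    (ContinuousLinearMap.continuous _).comp hωc
  have l2ω : ∫⁻ x, ‖curl (u t) x‖ₑ ^ 2 < ⊤ :=
    lt_of_le_of_lt (lintegral_curl_sq_le (u t)) (ENNReal.mul_lt_top ENNReal.ofReal_lt_top (hfin 1 t htS))
  have l2P : ∫⁻ x, ‖(ContinuousLinearMap.id ℝ (EuclideanSpace ℝ (Fin 3)) - ContinuousLinearMap.smulRight (EuclideanSpace.proj k : EuclideanSpace ℝ (Fin 3) →L[ℝ] ℝ) (EuclideanSpace.basisFun (Fin 3) ℝ k : EuclideanSpace ℝ (Fin 3))) (curl (u t) x)‖ₑ ^ 2 < ⊤ := by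
    refine lintegral_enorm_sq_lt_top_of_norm_le (fun x => ?_) (lintegral_enorm_sq_const_smul_lt_top (2 : ℝ) l2ω)
    rw [norm_smul, Real.norm_of_nonneg (by norm_num : (0 : ℝ) ≤ 2)]
    exact norm_dropC_apply_le_two_mul _ k
  have hiP : Integrable fun x => ‖(ContinuousLinearMap.id ℝ (EuclideanSpace ℝ (Fin 3)) - ContinuousLinearMap.smulRight (EuclideanSpace.proj k : EuclideanSpace ℝ (Fin 3) →L[ℝ] ℝ) (EuclideanSpace.basisFun (Fin 3) ℝ k : EuclideanSpace ℝ (Fin 3))) (curl (u t) x)‖ ^ 2 :=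
    integrable_sq_norm_of_lintegral_lt_top hPc l2P
  calc ∫⁻ x, ‖curl (u t) x j‖ₑ ^ 2 ≤ ∫⁻ x, ‖(ContinuousLinearMap.id ℝ (EuclideanSpace ℝ (Fin 3)) - ContinuousLinearMap.smulRight (EuclideanSpace.proj k : EuclideanSpace ℝ (Fin 3) →L[ℝ] ℝ) (EuclideanSpace.basisFun (Fin 3) ℝ k : EuclideanSpace ℝ (Fin 3))) (curl (u t) x)‖ₑ ^ 2 := by
        refine lintegral_mono fun x => ?_
        gcongr
        rw [← ofReal_norm, ← ofReal_norm, Real.norm_eq_abs]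
        exact ENNReal.ofReal_le_ofReal (abs_apply_le_norm_dropC _ hj)
    _ = ENNReal.ofReal (∫ x, ‖(ContinuousLinearMap.id ℝ (EuclideanSpace ℝ (Fin 3)) - ContinuousLinearMap.smulRight (EuclideanSpace.proj k : EuclideanSpace ℝ (Fin 3) →L[ℝ] ℝ) (EuclideanSpace.basisFun (Fin 3) ℝ k : EuclideanSpace ℝ (Fin 3))) (curl (u t) x)‖ ^ 2) := by
        rw [ofReal_integral_eq_lintegral_ofReal hiP (Eventually.of_forall fun x => sq_nonneg _)]
        exact lintegral_congr fun x => by rw [← ofReal_norm, ENNReal.ofReal_pow (norm_nonneg _)]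
    _ ≤ ENNReal.ofReal M := ENNReal.ofReal_le_ofReal hY

/-! ### The endpoint `γ = ∞`, `α = 2` -/

/-- A continuous function on `ℝ³` is bounded pointwise by its `L^∞` norm (Lebesgue measure charges
open sets). [folklore] -/
private theorem enorm_le_eLpNorm_top_of_continuous_vg {F : Type*} [NormedAddCommGroup F]
    {f : EuclideanSpace ℝ (Fin 3) → F} (hf : Continuous f) (x : EuclideanSpace ℝ (Fin 3)) :
    ‖f x‖ₑ ≤ eLpNorm f ⊤ volume := by
  rw [eLpNorm_exponent_top]
  by_contra h
  rw [not_le] at h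
  have hU : IsOpen {y | eLpNormEssSup f volume < ‖f y‖ₑ} := isOpen_lt continuous_const hf.enorm
  have hnull : volume {y | eLpNormEssSup f volume < ‖f y‖ₑ} = 0 := by
    have hae : ∀ᵐ y ∂(volume : Measure (EuclideanSpace ℝ (Fin 3))), ‖f y‖ₑ ≤ eLpNormEssSup f volume :=
      ae_le_eLpNormEssSup
    rw [ae_iff] at hae
    simpa only [not_le] using hae
  have hem := (hU.measure_eq_zero_iff (μ := volume)).1 hnull
  have hx : x ∈ {y | eLpNormEssSup f volume < ‖f y‖ₑ} := h
  rw [hem] at hx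
  exact hx

/-- For a continuous function on `ℝ³` and a dense set `D`, the `L^∞` norm is the supremum over
`D`. [folklore] -/
private theorem eLpNorm_top_eq_iSup_of_continuous_vg {F : Type*} [NormedAddCommGroup F]
    {f : EuclideanSpace ℝ (Fin 3) → F} (hf : Continuous f) {D : Set (EuclideanSpace ℝ (Fin 3))}
    (hD : Dense D) : eLpNorm f ⊤ volume = ⨆ q : D, ‖f q‖ₑ := by
  refine le_antisymm ?_ (iSup_le fun q => enorm_le_eLpNorm_top_of_continuous_vg hf q)
  rw [eLpNorm_exponent_top]
  refine essSup_le_of_ae_le _ (Eventually.of_forall fun y => ?_)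
  have hC : IsClosed {z | ‖f z‖ₑ ≤ ⨆ q : D, ‖f q‖ₑ} := isClosed_le hf.enorm continuous_const
  have hDC : D ⊆ {z | ‖f z‖ₑ ≤ ⨆ q : D, ‖f q‖ₑ} := fun z hz => le_iSup (fun q : D => ‖f q‖ₑ) ⟨z, hz⟩
  have hy : y ∈ closure D := by rw [hD.closure_eq]; exact mem_univ _
  exact closure_minimal hDC hC hy

/-- Time measurability of the `L^∞` norms of the component gradients of a classical solution
on `(0, T)` (supremum over a countable dense set of continuous functions of `t`). [folklore] -/
private theorem aemeasurable_eLpNorm_top_proj_fderiv {ν T : ℝ}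
    {u : ℝ → (EuclideanSpace ℝ (Fin 3)) → (EuclideanSpace ℝ (Fin 3))}
    {p : ℝ → (EuclideanSpace ℝ (Fin 3)) → ℝ} (hsol : IsClassicalNSSolutionOn (Ico 0 T) ν 0 u p)
    (j : Fin 3) :
    AEMeasurable (fun t => eLpNorm (fun x => (EuclideanSpace.proj j :
      EuclideanSpace ℝ (Fin 3) →L[ℝ] ℝ).comp (fderiv ℝ (u t) x)) ⊤ volume)
      (volume.restrict (Ioo 0 T)) := by
  obtain ⟨D, hDc, hDd⟩ := TopologicalSpace.exists_countable_dense (EuclideanSpace ℝ (Fin 3))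
  haveI : Countable D := hDc.to_subtype
  have hD' : IsSmoothSpaceTimeOn (Ico 0 T) (fun t x => fderiv ℝ (u t) x) :=
    hsol.smooth_velocity.fderiv_slice (uniqueDiffOn_Ico 0 T)
  have hcD : ContinuousOn (fun z : ℝ × EuclideanSpace ℝ (Fin 3) => fderiv ℝ (u z.1) z.2)
      (Ioo 0 T ×ˢ univ) :=
    hD'.continuousOn.mono (prod_mono Ioo_subset_Ico_self Subset.rfl)
  -- each `t ↦ ‖∇u_j(t)(q)‖ₑ` is continuous on `(0,T)`
  have hq : ∀ q : D, AEMeasurable (fun t => ‖(EuclideanSpace.proj j :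
      EuclideanSpace ℝ (Fin 3) →L[ℝ] ℝ).comp (fderiv ℝ (u t) (q : EuclideanSpace ℝ (Fin 3)))‖ₑ)
      (volume.restrict (Ioo 0 T)) := by
    intro q
    have h1 : ContinuousOn (fun t => fderiv ℝ (u t) (q : EuclideanSpace ℝ (Fin 3))) (Ioo 0 T) := by
      have hm : MapsTo (fun t : ℝ => (t, (q : EuclideanSpace ℝ (Fin 3)))) (Ioo 0 T) (Ioo 0 T ×ˢ univ) :=
        fun t ht => ⟨ht, mem_univ _⟩
      exact hcD.comp (continuousOn_id.prodMk continuousOn_const) hm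
    have h2 : ContinuousOn (fun t => ‖(EuclideanSpace.proj j :
        EuclideanSpace ℝ (Fin 3) →L[ℝ] ℝ).comp (fderiv ℝ (u t) (q : EuclideanSpace ℝ (Fin 3)))‖ₑ)
        (Ioo 0 T) :=
      ((continuous_const.clm_comp continuous_id).continuousOn.comp h1 (mapsTo_univ _ _)).enorm
    exact h2.aemeasurable measurableSet_Ioo
  have hsup : AEMeasurable (fun t => ⨆ q : D, ‖(EuclideanSpace.proj j :
      EuclideanSpace ℝ (Fin 3) →L[ℝ] ℝ).comp (fderiv ℝ (u t) (q : EuclideanSpace ℝ (Fin 3)))‖ₑ)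
      (volume.restrict (Ioo 0 T)) := AEMeasurable.iSup hq
  refine hsup.congr ?_
  rw [EventuallyEq, ae_restrict_iff' measurableSet_Ioo]
  refine Eventually.of_forall fun t ht => ?_
  have hc : Continuous fun x => (EuclideanSpace.proj j : EuclideanSpace ℝ (Fin 3) →L[ℝ] ℝ).comp
      (fderiv ℝ (u t) x) :=
    continuous_const.clm_comp (((hsol.contDiff_velocity (Ioo_subset_Ico_self ht))).continuous_fderiv
      (by simp))
  exact (eLpNorm_top_eq_iSup_of_continuous_vg hc hDd).symm

/-- **The estimate (13) at the endpoint `γ = ∞`** (Chae–Choe 1999, proof of Thm. 2: "the case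
`γ = ∞` corresponds to the obvious limit … for the norms of the estimates", i.e.
`|∫(ω·∇)ṽ·ω̃| ≤ ‖ω‖₂‖∇ṽ‖_∞‖ω̃‖₂ ≤ ½‖ω‖²₂ + ½‖∇ṽ‖²_∞‖ω̃‖²₂`). For every `C^∞` field `v` on `ℝ³`
with `∇v` bounded and square integrable,
`2∫⟪P_kω, P_k((∇v)ω)⟫ ≤ ∫|ω|² + (‖∇v_{k+1}‖_∞ + ‖∇v_{k+2}‖_∞)² ∫|P_kω|²`
(pointwise `inner_dropC_apply_le`, `|∇v_j(x)| ≤ ‖∇v_j‖_∞`, and `2ab ≤ a² + b²`).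
[cite: ChaeChoe1999, proof of Thm. 2, (13) (p. 5)] -/
theorem two_mul_integral_proj_stretching_le_top (k : Fin 3)
    (v : EuclideanSpace ℝ (Fin 3) → EuclideanSpace ℝ (Fin 3)) (hv : ContDiff ℝ ∞ v)
    {B₁ : ℝ} (hB₁ : ∀ x, ‖fderiv ℝ v x‖ ≤ B₁) (hv1 : ∫⁻ x, ‖iteratedFDeriv ℝ 1 v x‖ₑ ^ 2 < ⊤) :
    2 * ∫ x, ⟪(ContinuousLinearMap.id ℝ (EuclideanSpace ℝ (Fin 3)) - ContinuousLinearMap.smulRight (EuclideanSpace.proj k : EuclideanSpace ℝ (Fin 3) →L[ℝ] ℝ) (EuclideanSpace.basisFun (Fin 3) ℝ k : EuclideanSpace ℝ (Fin 3))) (curl v x), (ContinuousLinearMap.id ℝ (EuclideanSpace ℝ (Fin 3)) - ContinuousLinearMap.smulRight (EuclideanSpace.proj k : EuclideanSpace ℝ (Fin 3) →L[ℝ] ℝ) (EuclideanSpace.basisFun (Fin 3) ℝ k : EuclideanSpace ℝ (Fin 3))) (fderiv ℝ v x (curl v x))⟫ ≤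
      (∫ x, ‖curl v x‖ ^ 2) +
        ((eLpNorm (fun x => (EuclideanSpace.proj (k + 1) : EuclideanSpace ℝ (Fin 3) →L[ℝ] ℝ).comp (fderiv ℝ v x)) ⊤ volume).toReal + (eLpNorm (fun x => (EuclideanSpace.proj (k + 2) : EuclideanSpace ℝ (Fin 3) →L[ℝ] ℝ).comp (fderiv ℝ v x)) ⊤ volume).toReal) ^ 2 *
          ∫ x, ‖(ContinuousLinearMap.id ℝ (EuclideanSpace ℝ (Fin 3)) - ContinuousLinearMap.smulRight (EuclideanSpace.proj k : EuclideanSpace ℝ (Fin 3) →L[ℝ] ℝ) (EuclideanSpace.basisFun (Fin 3) ℝ k : EuclideanSpace ℝ (Fin 3))) (curl v x)‖ ^ 2 := by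
  set P : EuclideanSpace ℝ (Fin 3) →L[ℝ] EuclideanSpace ℝ (Fin 3) := (ContinuousLinearMap.id ℝ (EuclideanSpace ℝ (Fin 3)) - ContinuousLinearMap.smulRight (EuclideanSpace.proj k : EuclideanSpace ℝ (Fin 3) →L[ℝ] ℝ) (EuclideanSpace.basisFun (Fin 3) ℝ k : EuclideanSpace ℝ (Fin 3))) with hPdef
  set om : EuclideanSpace ℝ (Fin 3) → EuclideanSpace ℝ (Fin 3) := curl v with homdef
  have hom : ContDiff ℝ ∞ om := contDiff_curl (n := ⊤) (hv.of_le (by exact_mod_cast le_top))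
  set w : EuclideanSpace ℝ (Fin 3) → EuclideanSpace ℝ (Fin 3) := fun x => P (om x) with hwdef
  have hw : ContDiff ℝ ∞ w := hom.continuousLinearMap_comp P
  have cω : Continuous om := hom.continuous
  have cw : Continuous w := hw.continuous
  have cDv : Continuous (fderiv ℝ v) := hv.continuous_fderiv (by simp)
  set G : Fin 3 → EuclideanSpace ℝ (Fin 3) → (EuclideanSpace ℝ (Fin 3) →L[ℝ] ℝ) := fun j x =>
    (EuclideanSpace.proj j : EuclideanSpace ℝ (Fin 3) →L[ℝ] ℝ).comp (fderiv ℝ v x) with hGdef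
  have cG : ∀ j, Continuous (G j) := fun j => continuous_const.clm_comp cDv
  have hB₁0 : 0 ≤ B₁ := (norm_nonneg _).trans (hB₁ 0)
  have hGle : ∀ j x, ‖G j x‖ ≤ ‖fderiv ℝ v x‖ := by
    intro j x
    refine ContinuousLinearMap.opNorm_le_bound _ (norm_nonneg _) fun y => ?_
    rw [hGdef]
    dsimp only
    rw [ContinuousLinearMap.comp_apply, Real.norm_eq_abs]
    exact (abs_apply_le_norm_vg _ j).trans ((fderiv ℝ v x).le_opNorm y)
  -- the `L^∞` norms of the component gradients are finite and bound them pointwise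
  have hGtop : ∀ j, eLpNorm (G j) ⊤ volume < ⊤ := fun j => by
    rw [eLpNorm_exponent_top]
    refine lt_of_le_of_lt (eLpNormEssSup_le_of_ae_enorm_bound (C := ENNReal.ofReal B₁)
      (Eventually.of_forall fun x => ?_)) ENNReal.ofReal_lt_top
    rw [← ofReal_norm]
    exact ENNReal.ofReal_le_ofReal ((hGle j x).trans (hB₁ x))
  set N : Fin 3 → ℝ := fun j => (eLpNorm (G j) ⊤ volume).toReal with hN
  have hN0 : ∀ j, 0 ≤ N j := fun j => ENNReal.toReal_nonneg
  have hGN : ∀ j x, ‖G j x‖ ≤ N j := by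
    intro j x
    have h := enorm_le_eLpNorm_top_of_continuous_vg (cG j) x
    rw [← ofReal_norm] at h
    exact (ENNReal.ofReal_le_iff_le_toReal (hGtop j).ne).1 h
  -- `ω, Pω ∈ L²`
  have l2ω : ∫⁻ x, ‖om x‖ₑ ^ 2 < ⊤ :=
    lt_of_le_of_lt (lintegral_curl_sq_le v) (ENNReal.mul_lt_top ENNReal.ofReal_lt_top hv1)
  have l2w : ∫⁻ x, ‖w x‖ₑ ^ 2 < ⊤ := by
    refine lintegral_enorm_sq_lt_top_of_norm_le (fun x => ?_) (lintegral_enorm_sq_const_smul_lt_top (2 : ℝ) l2ω)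
    rw [norm_smul, Real.norm_of_nonneg (by norm_num : (0 : ℝ) ≤ 2)]
    exact norm_dropC_apply_le_two_mul (om x) k
  have i_Z : Integrable (fun x => ‖om x‖ ^ 2) volume := integrable_sq_norm_of_lintegral_lt_top cω l2ω
  have i_a : Integrable (fun x => ‖w x‖ ^ 2) volume := integrable_sq_norm_of_lintegral_lt_top cw l2w
  -- pointwise: `2⟪Pω, P(∇v ω)⟫ ≤ |ω|² + (N₁+N₂)² |Pω|²`
  set Ns : ℝ := N (k + 1) + N (k + 2) with hNs
  have hNs0 : 0 ≤ Ns := add_nonneg (hN0 _) (hN0 _)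
  have hpt : ∀ x, 2 * ⟪w x, P (fderiv ℝ v x (om x))⟫ ≤ ‖om x‖ ^ 2 + Ns ^ 2 * ‖w x‖ ^ 2 := by
    intro x
    have h1 : ⟪w x, P (fderiv ℝ v x (om x))⟫ ≤ ‖w x‖ * ((‖G (k + 1) x‖ + ‖G (k + 2) x‖) * ‖om x‖) :=
      inner_dropC_apply_le (om x) (fderiv ℝ v x) k
    have h2 : ‖G (k + 1) x‖ + ‖G (k + 2) x‖ ≤ Ns := add_le_add (hGN _ x) (hGN _ x)
    have h3 : ‖w x‖ * ((‖G (k + 1) x‖ + ‖G (k + 2) x‖) * ‖om x‖) ≤ ‖w x‖ * (Ns * ‖om x‖) := by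
      gcongr
    nlinarith [h1, h3, sq_nonneg (‖om x‖ - Ns * ‖w x‖), norm_nonneg (w x), norm_nonneg (om x)]
  have hle : ∫ x, 2 * ⟪w x, P (fderiv ℝ v x (om x))⟫ ≤ ∫ x, (‖om x‖ ^ 2 + Ns ^ 2 * ‖w x‖ ^ 2) := by
    have hI : Integrable (fun x => ‖om x‖ ^ 2 + Ns ^ 2 * ‖w x‖ ^ 2) volume := i_Z.add (i_a.const_mul _)
    by_cases hS : Integrable (fun x => 2 * ⟪w x, P (fderiv ℝ v x (om x))⟫) volume
    · exact integral_mono hS hI hpt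
    · rw [integral_undef hS]
      exact integral_nonneg fun x => by positivity
  have hI2 : ∫ x, (‖om x‖ ^ 2 + Ns ^ 2 * ‖w x‖ ^ 2) = (∫ x, ‖om x‖ ^ 2) + Ns ^ 2 * ∫ x, ‖w x‖ ^ 2 := by
    rw [integral_add i_Z (i_a.const_mul _), integral_const_mul]
  have hI1 : ∫ x, 2 * ⟪w x, P (fderiv ℝ v x (om x))⟫ = 2 * ∫ x, ⟪w x, P (fderiv ℝ v x (om x))⟫ :=
    integral_const_mul _ _
  rw [hI1, hI2] at hle
  exact hle

set_option maxHeartbeats 1600000 in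
/-- **Chae–Choe's second criterion at the endpoint `γ = ∞`, `α = 2`** (Chae–Choe 1999, Thm. 2 with
`Dṽ ∈ L²(0,T; L^∞)`, `2/2 + 3/∞ = 1`). For a classical unforced solution on `ℝ³ × [0, T)` in the
Beale–Kato–Majda class: if for an index `k` the gradients of the two other velocity components lie
in `L²(0,T; L^∞(ℝ³))`, then the solution continues in the class past `T`. Proof:
`two_mul_integral_proj_stretching_le_top` at every time of each slab, the slab bound
`integral_sq_norm_clm_curl_le_of_weight_slab_ae` with the weight
`2(‖∇u_{k+1}(t)‖²_∞ + ‖∇u_{k+2}(t)‖²_∞)` (integrable; measurable in time by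
`aemeasurable_eLpNorm_top_proj_fderiv`) and the enstrophy forcing (Tao's dissipation budget),
`|ω_j| ≤ |P_kω|`, and `hasSobolevExtensionPast_of_two_vorticity_components_bounded`.
[cite: ChaeChoe1999, Thm. 2 (p. 2) and proof, (13) (pp. 5–6); Tao2011, Lemma 8.1] -/
theorem chaeChoe_two_velocity_gradients_criterion_top {ν : ℝ} (hν : 0 < ν) {T : ℝ} (hT : 0 < T)
    {u : ℝ → (EuclideanSpace ℝ (Fin 3)) → (EuclideanSpace ℝ (Fin 3))}
    {p : ℝ → (EuclideanSpace ℝ (Fin 3)) → ℝ}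
    (hsol : IsClassicalNSSolutionOn (Ico 0 T) ν 0 u p)
    (hreg : ∀ T'' < T, HasBoundedSobolevNormsOn (Icc 0 T'') u) (k : Fin 3)
    (hG : ∀ j, j ≠ k → MemLqLp 2 ⊤
      (fun t x => (EuclideanSpace.proj j : EuclideanSpace ℝ (Fin 3) →L[ℝ] ℝ).comp (fderiv ℝ (u t) x))
      (Ioo 0 T)) :
    HasSobolevExtensionPast ν u T := by
  obtain ⟨Ce, hCetop, hTao⟩ := tao_finite_energy_smooth_energy_bound_holds
  -- the component gradients and their time weights
  set Gr : Fin 3 → ℝ → EuclideanSpace ℝ (Fin 3) → (EuclideanSpace ℝ (Fin 3) →L[ℝ] ℝ) :=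
    fun j t x => (EuclideanSpace.proj j : EuclideanSpace ℝ (Fin 3) →L[ℝ] ℝ).comp (fderiv ℝ (u t) x)
    with hGr
  set N : Fin 3 → ℝ → ℝ := fun j t => (eLpNorm (Gr j t) ⊤ volume).toReal with hN
  have hN0 : ∀ j t, 0 ≤ N j t := fun j t => ENNReal.toReal_nonneg
  obtain ⟨hI1, -⟩ := lintegral_ofReal_toReal_rpow_lt_top (q := 2) (by norm_num) (by norm_num)
    (hG (k + 1) (fin3_add_one_ne_vg k))
  obtain ⟨hI2, -⟩ := lintegral_ofReal_toReal_rpow_lt_top (q := 2) (by norm_num) (by norm_num)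
    (hG (k + 2) (fin3_add_two_ne_vg k))
  rw [ENNReal.toReal_ofNat] at hI1 hI2
  set I₁ : ℝ≥0∞ := ∫⁻ t in Ioo 0 T, ENNReal.ofReal (N (k + 1) t ^ (2 : ℝ)) with hI₁
  set I₂ : ℝ≥0∞ := ∫⁻ t in Ioo 0 T, ENNReal.ofReal (N (k + 2) t ^ (2 : ℝ)) with hI₂
  have hI₁top : I₁ < ⊤ := hI1
  have hI₂top : I₂ < ⊤ := hI2
  set a : ℝ → ℝ := fun t => 2 * (N (k + 1) t ^ (2 : ℝ) + N (k + 2) t ^ (2 : ℝ)) with ha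
  have ha0 : ∀ t, 0 ≤ a t := fun t => by positivity
  set Aw : ℝ := 2 * (I₁ + I₂).toReal with hAw
  have hAw0 : 0 ≤ Aw := by positivity
  have haE : ∀ t, ENNReal.ofReal (a t) =
      2 * (ENNReal.ofReal (N (k + 1) t ^ (2 : ℝ)) + ENNReal.ofReal (N (k + 2) t ^ (2 : ℝ))) := by
    intro t
    rw [ha]; dsimp only
    rw [ENNReal.ofReal_mul (by norm_num), ENNReal.ofReal_add (by positivity) (by positivity),
      ENNReal.ofReal_ofNat]
  have hNmeas : ∀ j, AEMeasurable (fun t => ENNReal.ofReal (N j t ^ (2 : ℝ))) (volume.restrict (Ioo 0 T)) := by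
    intro j
    have hE : AEMeasurable (fun t => eLpNorm (Gr j t) ⊤ volume) (volume.restrict (Ioo 0 T)) :=
      aemeasurable_eLpNorm_top_proj_fderiv hsol j
    have hNj : AEMeasurable (N j) (volume.restrict (Ioo 0 T)) :=
      ENNReal.measurable_toReal.comp_aemeasurable hE
    exact ENNReal.measurable_ofReal.comp_aemeasurable (hNj.pow_const _)
  have hAint : ∀ T'' ≤ T, ∫⁻ t in Ioo 0 T'', ENNReal.ofReal (a t) ≤ ENNReal.ofReal Aw := by
    intro T'' hT''
    calc ∫⁻ t in Ioo 0 T'', ENNReal.ofReal (a t)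
        ≤ ∫⁻ t in Ioo 0 T, ENNReal.ofReal (a t) := lintegral_mono_set (Ioo_subset_Ioo le_rfl hT'')
      _ = ∫⁻ t in Ioo 0 T, 2 *
            (ENNReal.ofReal (N (k + 1) t ^ (2 : ℝ)) + ENNReal.ofReal (N (k + 2) t ^ (2 : ℝ))) :=
          lintegral_congr fun t => haE t
      _ = 2 * (I₁ + I₂) := by
          rw [lintegral_const_mul' _ _ (by norm_num), lintegral_add_left' (hNmeas (k + 1))]
      _ = ENNReal.ofReal Aw := by
          rw [hAw, ENNReal.ofReal_mul (by norm_num), ENNReal.ofReal_ofNat, ENNReal.ofReal_toReal]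
          exact (ENNReal.add_lt_top.2 ⟨hI₁top, hI₂top⟩).ne
  -- the initial energy and the dissipation budget
  have hreg0 : HasBoundedSobolevNormsOn (Icc 0 (T / 2)) u := hreg (T / 2) (by linarith)
  have h00 : (0 : ℝ) ∈ Icc 0 (T / 2) := ⟨le_rfl, by linarith⟩
  set E₀ : ℝ≥0∞ := ∫⁻ x, ‖u 0 x‖ₑ ^ 2 with hE₀
  have hE₀top : E₀ < ⊤ := by
    obtain ⟨C0, hC0'⟩ := hreg0 0
    refine lt_of_le_of_lt (le_of_eq (lintegral_congr fun x => ?_)) ((hC0' 0 h00).trans_lt ENNReal.coe_lt_top)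
    rw [← ofReal_norm, ← ofReal_norm, norm_iteratedFDeriv_zero]
  set κ : ℝ := ‖curlCLM‖ with hκ
  have hν0 : ENNReal.ofReal ν ≠ 0 := (ENNReal.ofReal_pos.2 hν).ne'
  set E₁E : ℝ≥0∞ := ENNReal.ofReal (κ ^ 2) * (Ce * E₀ / ENNReal.ofReal ν) with hE₁E
  have hE₁Etop : E₁E < ⊤ := ENNReal.mul_lt_top ENNReal.ofReal_lt_top
    (ENNReal.div_lt_top (ENNReal.mul_ne_top hCetop.ne hE₀top.ne) hν0)
  set E₁ : ℝ := E₁E.toReal with hE₁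
  have hE₁0 : 0 ≤ E₁ := ENNReal.toReal_nonneg
  have hE₁of : ENNReal.ofReal E₁ = E₁E := ENNReal.ofReal_toReal hE₁Etop.ne
  set Y₀ : ℝ := ∫ x, ‖(ContinuousLinearMap.id ℝ (EuclideanSpace ℝ (Fin 3)) - ContinuousLinearMap.smulRight (EuclideanSpace.proj k : EuclideanSpace ℝ (Fin 3) →L[ℝ] ℝ) (EuclideanSpace.basisFun (Fin 3) ℝ k : EuclideanSpace ℝ (Fin 3))) (curl (u 0) x)‖ ^ 2 with hY₀
  have hY₀0 : 0 ≤ Y₀ := integral_nonneg fun x => sq_nonneg _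
  set M : ℝ := (Y₀ + 1 * E₁) * Real.exp Aw with hM
  -- the uniform bound on `∫|ω_j|²`, then Thm. 1
  refine hasSobolevExtensionPast_of_two_vorticity_components_bounded hν hT hsol hreg k (M := M) ?_
  intro j hj t ht'
  have ht : t ∈ Ico 0 T := Ioo_subset_Ico_self ht'
  -- a closed slab containing `t`
  set T'' : ℝ := (t + T) / 2 with hT''def
  have htT'' : t < T'' := by rw [hT''def]; linarith [ht.2]
  have hT''T : T'' < T := by rw [hT''def]; linarith [ht.2]
  have hT''pos : 0 < T'' := lt_of_le_of_lt ht.1 htT''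
  have hS : IsClassicalNSSolutionOn (Icc 0 T'') ν 0 u p :=
    hsol.mono (Icc_subset_Ico_right hT''T) (uniqueDiffOn_Icc hT''pos)
  have hB : HasBoundedSobolevNormsOn (Icc 0 T'') u := hreg T'' hT''T
  have htS : t ∈ Icc 0 T'' := ⟨ht.1, htT''.le⟩
  have hsm : ∀ s ∈ Icc 0 T'', ContDiff ℝ ∞ (u s) := fun s hs => hS.contDiff_velocity hs
  have hsm3 : ∀ s ∈ Icc 0 T'', ContDiff ℝ 3 (u s) := fun s hs => (hsm s hs).of_le (by norm_cast)
  have hfin : ∀ n, ∀ s ∈ Icc 0 T'', ∫⁻ x, ‖iteratedFDeriv ℝ n (u s) x‖ₑ ^ 2 < ⊤ := fun n s hs => by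
    obtain ⟨Cn, hCn⟩ := hB n
    exact (hCn s hs).trans_lt ENNReal.coe_lt_top
  obtain ⟨B₁, hB₁0, hB₁⟩ := exists_forall_norm_fderiv_le_of_hasBoundedSobolevNormsOn hsm3 hB
  -- Tao's energy class on the slab: the dissipation budget
  have hfe : ∃ A : ℝ≥0∞, A < ⊤ ∧ ∀ s ∈ Icc 0 T'', ∫⁻ x, ‖u s x‖ₑ ^ 2 ≤ A := by
    obtain ⟨C0, hC0'⟩ := hB 0
    refine ⟨C0, ENNReal.coe_lt_top, fun s hs => ?_⟩
    refine le_trans (le_of_eq (lintegral_congr fun x => ?_)) (hC0' s hs)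
    rw [← ofReal_norm, ← ofReal_norm, norm_iteratedFDeriv_zero]
  obtain ⟨-, hdis⟩ := hTao ν T'' hν hT''pos u p hS hfe
  have hdis' : ∫⁻ s in Ioo 0 T'', ∫⁻ x, ENNReal.ofReal (frobeniusNormSq (fderiv ℝ (u s) x)) ≤
      Ce * E₀ / ENNReal.ofReal ν := by
    rw [ENNReal.le_div_iff_mul_le (Or.inl hν0) (Or.inl ENNReal.ofReal_ne_top), mul_comm]
    exact hdis
  have hE₁slab : ∫⁻ s in Ioo 0 T'', ENNReal.ofReal (∫ x, ‖curl (u s) x‖ ^ 2) ≤ ENNReal.ofReal E₁ := by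
    rw [hE₁of, hE₁E]
    have hpt : ∀ s ∈ Ioo 0 T'', ENNReal.ofReal (∫ x, ‖curl (u s) x‖ ^ 2) ≤
        ENNReal.ofReal (κ ^ 2) * ∫⁻ x, ENNReal.ofReal (frobeniusNormSq (fderiv ℝ (u s) x)) := by
      intro s hs
      have hsS : s ∈ Icc 0 T'' := ⟨hs.1.le, hs.2.le⟩
      have hωc : Continuous (curl (u s)) := continuous_curl ((hsm s hsS).of_le (by norm_cast))
      have hi : Integrable fun x => ‖curl (u s) x‖ ^ 2 := by
        refine integrable_sq_norm_of_lintegral_lt_top hωc ?_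
        exact lt_of_le_of_lt (lintegral_curl_sq_le (u s))
          (ENNReal.mul_lt_top ENNReal.ofReal_lt_top (hfin 1 s hsS))
      rw [ofReal_integral_eq_lintegral_ofReal hi (Eventually.of_forall fun x => sq_nonneg _)]
      have h1 : ∫⁻ x, ENNReal.ofReal (‖curl (u s) x‖ ^ 2) = ∫⁻ x, ‖curl (u s) x‖ₑ ^ 2 :=
        lintegral_congr fun x => by rw [← ofReal_norm, ENNReal.ofReal_pow (norm_nonneg _)]
      rw [h1]
      refine (lintegral_curl_sq_le (u s)).trans (mul_le_mul' le_rfl (lintegral_mono fun x => ?_))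
      rw [← ofReal_norm, norm_iteratedFDeriv_one (u s), ← ENNReal.ofReal_pow (norm_nonneg _)]
      exact ENNReal.ofReal_le_ofReal (sq_opNorm_le_frobeniusNormSq _)
    calc ∫⁻ s in Ioo 0 T'', ENNReal.ofReal (∫ x, ‖curl (u s) x‖ ^ 2)
        ≤ ∫⁻ s in Ioo 0 T'', ENNReal.ofReal (κ ^ 2) *
            ∫⁻ x, ENNReal.ofReal (frobeniusNormSq (fderiv ℝ (u s) x)) := setLIntegral_mono' measurableSet_Ioo hpt
      _ = ENNReal.ofReal (κ ^ 2) *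
            ∫⁻ s in Ioo 0 T'', ∫⁻ x, ENNReal.ofReal (frobeniusNormSq (fderiv ℝ (u s) x)) :=
          lintegral_const_mul' _ _ ENNReal.ofReal_ne_top
      _ ≤ ENNReal.ofReal (κ ^ 2) * (Ce * E₀ / ENNReal.ofReal ν) := mul_le_mul' le_rfl hdis'
  -- the stretching estimate at every time of the slab
  have hstrS : ∀ᵐ s ∂(volume.restrict (Ioo 0 T'')),
      2 * ∫ x, ⟪(ContinuousLinearMap.id ℝ (EuclideanSpace ℝ (Fin 3)) - ContinuousLinearMap.smulRight (EuclideanSpace.proj k : EuclideanSpace ℝ (Fin 3) →L[ℝ] ℝ) (EuclideanSpace.basisFun (Fin 3) ℝ k : EuclideanSpace ℝ (Fin 3))) (curl (u s) x), (ContinuousLinearMap.id ℝ (EuclideanSpace ℝ (Fin 3)) - ContinuousLinearMap.smulRight (EuclideanSpace.proj k : EuclideanSpace ℝ (Fin 3) →L[ℝ] ℝ) (EuclideanSpace.basisFun (Fin 3) ℝ k : EuclideanSpace ℝ (Fin 3))) (fderiv ℝ (u s) x (curl (u s) x))⟫ ≤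
        ν * (∫ x, frobeniusNormSq (fderiv ℝ (fun y => (ContinuousLinearMap.id ℝ (EuclideanSpace ℝ (Fin 3)) - ContinuousLinearMap.smulRight (EuclideanSpace.proj k : EuclideanSpace ℝ (Fin 3) →L[ℝ] ℝ) (EuclideanSpace.basisFun (Fin 3) ℝ k : EuclideanSpace ℝ (Fin 3))) (curl (u s) y)) x)) +
          1 * (∫ x, ‖curl (u s) x‖ ^ 2) + a s * (∫ x, ‖(ContinuousLinearMap.id ℝ (EuclideanSpace ℝ (Fin 3)) - ContinuousLinearMap.smulRight (EuclideanSpace.proj k : EuclideanSpace ℝ (Fin 3) →L[ℝ] ℝ) (EuclideanSpace.basisFun (Fin 3) ℝ k : EuclideanSpace ℝ (Fin 3))) (curl (u s) x)‖ ^ 2) := by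
    rw [ae_restrict_iff' measurableSet_Ioo]
    refine Eventually.of_forall fun s hsI => ?_
    have hsS : s ∈ Icc 0 T'' := ⟨hsI.1.le, hsI.2.le⟩
    have h := two_mul_integral_proj_stretching_le_top k (u s) (hsm s hsS) (hB₁ s hsS) (hfin 1 s hsS)
    have hR0 : 0 ≤ ∫ x, frobeniusNormSq (fderiv ℝ (fun y => (ContinuousLinearMap.id ℝ (EuclideanSpace ℝ (Fin 3)) - ContinuousLinearMap.smulRight (EuclideanSpace.proj k : EuclideanSpace ℝ (Fin 3) →L[ℝ] ℝ) (EuclideanSpace.basisFun (Fin 3) ℝ k : EuclideanSpace ℝ (Fin 3))) (curl (u s) y)) x) :=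
      integral_nonneg fun x => frobeniusNormSq_nonneg _
    have hY0' : 0 ≤ ∫ x, ‖(ContinuousLinearMap.id ℝ (EuclideanSpace ℝ (Fin 3)) - ContinuousLinearMap.smulRight (EuclideanSpace.proj k : EuclideanSpace ℝ (Fin 3) →L[ℝ] ℝ) (EuclideanSpace.basisFun (Fin 3) ℝ k : EuclideanSpace ℝ (Fin 3))) (curl (u s) x)‖ ^ 2 := integral_nonneg fun x => sq_nonneg _
    have hcoef : (N (k + 1) s + N (k + 2) s) ^ 2 ≤ a s := by
      rw [ha]; dsimp only
      rw [Real.rpow_two, Real.rpow_two]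
      nlinarith [sq_nonneg (N (k + 1) s - N (k + 2) s)]
    have hNdef : (eLpNorm (Gr (k + 1) s) ⊤ volume).toReal + (eLpNorm (Gr (k + 2) s) ⊤ volume).toReal =
        N (k + 1) s + N (k + 2) s := rfl
    rw [hNdef] at h
    rw [one_mul]
    nlinarith [h, hcoef, hR0, hY0', hν]
  -- the slab bound for `∫|P_k ω|²`
  have hY := integral_sq_norm_clm_curl_le_of_weight_slab_ae hν hT''pos hS hB (ContinuousLinearMap.id ℝ (EuclideanSpace ℝ (Fin 3)) - ContinuousLinearMap.smulRight (EuclideanSpace.proj k : EuclideanSpace ℝ (Fin 3) →L[ℝ] ℝ) (EuclideanSpace.basisFun (Fin 3) ℝ k : EuclideanSpace ℝ (Fin 3))) ha0 hAw0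
    (hAint T'' hT''T.le) zero_le_one hE₁0 hE₁slab hstrS t htS
  -- `∫|ω_j|² ≤ ∫|P_k ω|²`
  have hvt : ContDiff ℝ ∞ (u t) := hS.contDiff_velocity htS
  have hωc : Continuous (curl (u t)) := continuous_curl (hvt.of_le (by norm_cast))
  have hPc : Continuous fun x => (ContinuousLinearMap.id ℝ (EuclideanSpace ℝ (Fin 3)) - ContinuousLinearMap.smulRight (EuclideanSpace.proj k : EuclideanSpace ℝ (Fin 3) →L[ℝ] ℝ) (EuclideanSpace.basisFun (Fin 3) ℝ k : EuclideanSpace ℝ (Fin 3))) (curl (u t) x) :=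
    (ContinuousLinearMap.continuous _).comp hωc
  have l2ω : ∫⁻ x, ‖curl (u t) x‖ₑ ^ 2 < ⊤ :=
    lt_of_le_of_lt (lintegral_curl_sq_le (u t)) (ENNReal.mul_lt_top ENNReal.ofReal_lt_top (hfin 1 t htS))
  have l2P : ∫⁻ x, ‖(ContinuousLinearMap.id ℝ (EuclideanSpace ℝ (Fin 3)) - ContinuousLinearMap.smulRight (EuclideanSpace.proj k : EuclideanSpace ℝ (Fin 3) →L[ℝ] ℝ) (EuclideanSpace.basisFun (Fin 3) ℝ k : EuclideanSpace ℝ (Fin 3))) (curl (u t) x)‖ₑ ^ 2 < ⊤ := by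
    refine lintegral_enorm_sq_lt_top_of_norm_le (fun x => ?_) (lintegral_enorm_sq_const_smul_lt_top (2 : ℝ) l2ω)
    rw [norm_smul, Real.norm_of_nonneg (by norm_num : (0 : ℝ) ≤ 2)]
    exact norm_dropC_apply_le_two_mul _ k
  have hiP : Integrable fun x => ‖(ContinuousLinearMap.id ℝ (EuclideanSpace ℝ (Fin 3)) - ContinuousLinearMap.smulRight (EuclideanSpace.proj k : EuclideanSpace ℝ (Fin 3) →L[ℝ] ℝ) (EuclideanSpace.basisFun (Fin 3) ℝ k : EuclideanSpace ℝ (Fin 3))) (curl (u t) x)‖ ^ 2 :=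
    integrable_sq_norm_of_lintegral_lt_top hPc l2P
  calc ∫⁻ x, ‖curl (u t) x j‖ₑ ^ 2 ≤ ∫⁻ x, ‖(ContinuousLinearMap.id ℝ (EuclideanSpace ℝ (Fin 3)) - ContinuousLinearMap.smulRight (EuclideanSpace.proj k : EuclideanSpace ℝ (Fin 3) →L[ℝ] ℝ) (EuclideanSpace.basisFun (Fin 3) ℝ k : EuclideanSpace ℝ (Fin 3))) (curl (u t) x)‖ₑ ^ 2 := by
        refine lintegral_mono fun x => ?_
        gcongr
        rw [← ofReal_norm, ← ofReal_norm, Real.norm_eq_abs]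
        exact ENNReal.ofReal_le_ofReal (abs_apply_le_norm_dropC _ hj)
    _ = ENNReal.ofReal (∫ x, ‖(ContinuousLinearMap.id ℝ (EuclideanSpace ℝ (Fin 3)) - ContinuousLinearMap.smulRight (EuclideanSpace.proj k : EuclideanSpace ℝ (Fin 3) →L[ℝ] ℝ) (EuclideanSpace.basisFun (Fin 3) ℝ k : EuclideanSpace ℝ (Fin 3))) (curl (u t) x)‖ ^ 2) := by
        rw [ofReal_integral_eq_lintegral_ofReal hiP (Eventually.of_forall fun x => sq_nonneg _)]
        exact lintegral_congr fun x => by rw [← ofReal_norm, ENNReal.ofReal_pow (norm_nonneg _)]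
    _ ≤ ENNReal.ofReal M := ENNReal.ofReal_le_ofReal hY

/-- **The endpoint `γ = ∞` with the printed `2/α ≤ 1`**: gradients of two velocity components in
`L^α(0,T; L^∞)` for some `2 ≤ α ≤ ∞` give continuation (Hölder in time to `α = 2`,
`MemLqLp.of_exponent_le` with `aemeasurable_eLpNorm_top_proj_fderiv`). [cite: ChaeChoe1999, Thm. 2 (p. 2)] -/
theorem chaeChoe_two_velocity_gradients_criterion_top_of_le {ν : ℝ} (hν : 0 < ν) {T : ℝ}
    (hT : 0 < T)
    {u : ℝ → (EuclideanSpace ℝ (Fin 3)) → (EuclideanSpace ℝ (Fin 3))}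
    {p : ℝ → (EuclideanSpace ℝ (Fin 3)) → ℝ}
    (hsol : IsClassicalNSSolutionOn (Ico 0 T) ν 0 u p)
    (hreg : ∀ T'' < T, HasBoundedSobolevNormsOn (Icc 0 T'') u) {α : ℝ≥0∞} (h2α : 2 ≤ α) (k : Fin 3)
    (hG : ∀ j, j ≠ k → MemLqLp α ⊤
      (fun t x => (EuclideanSpace.proj j : EuclideanSpace ℝ (Fin 3) →L[ℝ] ℝ).comp (fderiv ℝ (u t) x))
      (Ioo 0 T)) :
    HasSobolevExtensionPast ν u T := by
  refine chaeChoe_two_velocity_gradients_criterion_top hν hT hsol hreg k fun j hj => ?_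
  refine (hG j hj).of_exponent_le h2α measure_Ioo_lt_top.ne ?_
  exact (ENNReal.measurable_toReal.comp_aemeasurable
    (aemeasurable_eLpNorm_top_proj_fderiv hsol j)).aestronglyMeasurable

end Criterion

end Literature.Analysis.FluidPDE
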